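import Summits.RiemannHypothesis.RiemannHypothesis.Theses.SpectralTrace
import Literature.NumberTheory.LFunctions.WeilExplicitProofs
import Literature.NumberTheory.LFunctions.WeilExplicitFormulaProofs
import Literature.NumberTheory.LFunctions.WeilCriterionProofs
import Literature.NumberTheory.LFunctions.WeilSmallSupportPositivity
import Literature.NumberTheory.LFunctions.WeilGroundState
import Literature.NumberTheory.LFunctions.WeilArchimedeanPositivityProofs
import Literature.NumberTheory.LFunctions.AdversarialWeilPositivity
import Literature.NumberTheory.LFunctions.WeilWindowSimpleEven
import Literature.NumberTheory.LFunctions.WeilMellinInversion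
import Literature.NumberTheory.LFunctions.WeilExplicitArchTermProofs
import Mathlib.Analysis.Fourier.PoissonSummation
import Literature.NumberTheory.LFunctions.KadiriGammaRemainder
import Literature.NumberTheory.LFunctions.RiemannSiegelStirling
import Summits.RiemannHypothesis.RiemannHypothesis.Theorems.WindowTracePrime2.Negative.FiniteFamilies

/-!
# Disproof of `WindowTracePrime2` (stmt-RiemannHypothesis-11196, route `SpectralTrace`) — findings

Crux (rank 3): `∃ (ι : Type) (γ : ι → ℝ), ∀ g, IsWeilTest g → tsupport g ⊆ [-log 3, log 3] →
HasSum (fun i ↦ ĝ(1/2 + iγ_i)) (W g)` — a REAL family with integer multiplicities whose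
exponential sum reproduces the Weil distribution on the window `(-log 3, log 3)` (= `Trace (log 3)`
below, `windowTracePrime2_iff`, by `Iff.rfl`).

Standing adversary: refuter-cdisprove-stmt-RiemannHypothesis-11196-0 (cycle 1, 2026-08-16).
Everything below is sorry-free (`lean check` rc 0); prose only in docstrings.

LANDED IN THE TREE (importable; namespace `Summit.RiemannHypothesis.RiemannHypothesis.Theorems.
WindowTracePrime2.Negative`, statements in INLINE-hypothesis form, no `Trace` def):
`Theorems/WindowTracePrime2/Negative/FiniteFamilies.lean` (p72914: `not_trace_of_finite`,
`finite_abs_le_of_trace`, `not_trace_of_bounded`, `finite_fibre_of_trace`, …),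
`…/Negative/LoadBearing.lean` (p73528: `windowTracePrime2_false_without_IsWeilTest`,
`hasSum_nontrivialZeros`, `not_riemannHypothesis_of_not_windowTracePrime2`),
`…/Negative/Poisson.lean` (p74451: `fourier_lineSample`, `tsum_lineSample`, `tsum_lineSample_eq_zero'`),
`…/Negative/BumpPositivity.lean` (p74842: `weilFunctional_bumpC_re_pos`, …),
`…/Negative/Progressions.lean` (p75783: `not_trace_progressions`, `not_windowTracePrime2_progressions`,
`not_windowTracePrime2_progression`, `not_windowTraceArch_progressions`),
`…/Negative/Modulation.lean` (p77629: `weilMellin_modulate`, `hasSum_norm_sq_shift`, polar/prime bounds),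
`…/Negative/ArchBound.lean` (p98682: `archIntegral_modulate_le`, `re_weilFunctional_modulate_le`,
`ncard_near_le`), `…/Negative/Regrouping.lean` (p99782: `sum_inv_one_add_sq_le`,
`re_weilFunctional_modulate_le_of_ncard_le`);
NOT YET LANDED (file ready, rc0 validated: the seat folder's `NegLocalCounts.lean`, target
`…/Negative/LocalCounts.lean`, contents = the lower-bound half of §(W) below incl. `not_trace_of_ncard_le`;
the gate refused the seat's identity after a session resume — to be proposed at the next re-arm).

Index of this work file:

* (R) RESISTANCE — WHY NO KILL EXISTS SHORT OF `¬RH`. `hasSum_zeros`: UNCONDITIONALLY the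
  non-trivial zeros with multiplicity (`ZeroIdx`) give `HasSum (fun i ↦ ĝ(ρ_i)) (W g)` for every
  Weil test (the tree's kernel-checked explicit formula `explicit_formula_holds` +
  `summable_norm_zeroSide`, regrouped over `Σ ρ, Fin m(ρ)`). Hence
  `trace_of_riemannHypothesis : RH → Trace A` for EVERY `A`, `windowTracePrime2_of_riemannHypothesis`,
  and `not_riemannHypothesis_of_not_windowTracePrime2 : ¬crux → ¬RH`. No counterexample search,
  small model or limiting regime can refute the crux without refuting RH; none is attempted beyond
  the structural theorems below, which instead map WHERE a witness must live.
* (L) LOAD-BEARING HYPOTHESES, as theorems.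
  - `IsWeilTest`: `windowTracePrime2_false_without_IsWeilTest` — dropped, the statement is FALSE
    (witness `spike = 𝟙_{{0}}`: all `ĝ = 0` but `W(spike) = -log π`; pointwise values `g 0`,
    `g (±log 2)` enter `W`, so continuity/smoothness is used by any proof).
  - realness `γ : ι → ℝ`: `windowTracePrime2WithoutReal_holds` — weakened to `ρ : ι → ℂ` the
    statement is a THEOREM (witness: the zeta zeros). Realness carries ALL the difficulty.
  - the window `tsupport g ⊆ [-log 3, log 3]`: dropped, the statement is `SpectralThesis`
    (`Iff.rfl`) and `windowTracePrime2WithoutWindow_iff_riemannHypothesis : SpectralThesis ↔ RH`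
    (via `weilPositivity_of_spectralThesis` + `weil_criterion_holds`). So no `_false_without_window`
    theorem can exist short of `¬RH` — the window is what makes the crux POSSIBLY weaker than RH.
  - symmetry: `Trace.neg` / `windowTracePrime2_neg_iff` — `W` is even, so `-γ` is a witness with
    `γ` (no sign/chirality constraint exists to exploit).
  - boundary of the parameter: `trace_of_nonpos` (`A ≤ 0`: the EMPTY family is a junk witness)
    vs `not_trace_of_isEmpty` (`A > 0`: it is not); `Trace.anti` (monotone in the window), hence
    `windowTraceArch_of_windowTracePrime2` (crux ⇒ its declared dependency `WindowTraceArch`) and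
    `windowTracePrime2_of_spectralThesis` (target ⇒ crux: a strict weakening, not a restatement).
* (F) FAITHFULNESS. `weilPrimeTerm_of_window_three`: on the closed window only `n = 2` enters,
  `weilPrimeTerm g = (log 2/√2)(g(log 2) + g(-log 2))` (`g(±log 3) = 0` since supports are open),
  exactly the informal spike; `weilFunctional_of_window_three`.
* (S) NATURAL STRENGTHENINGS REFUTED = necessary STRUCTURE of any witness (all levels `A > 0`):
  - `not_trace_of_finite` / `not_windowTracePrime2_finite` / `infinite_of_trace`: NO FINITE family
    (Bombieri Thm 12 coercivity `Re W(g⋆g̃) ≥ (N+1)‖g‖²` on small support vs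
    `Σ_{i≤N} |ĝ(γ_i)|² ≤ N(∫|g|)² ≤ N`); in particular `W ≢ 0` on every window.
  - `finite_abs_le_of_trace`: every witness is LOCALLY FINITE — `{i : |γ_i| ≤ K}` is finite for
    every `K` (narrow non-negative bump `g`: `Σ|ĝ(γ_i)|² < ∞` while `|ĝ(γ)| ≥ cos 1·∫g` on
    `|γ| ≤ K`); so `not_trace_of_bounded` (no bounded family), `finite_fibre_of_trace` (finite
    multiplicities, no accumulation point). This is also the input the support items
    `SpectralPackaging` (11199) and `WindowCompactness` (11197) need, proved here for any rung.
  - `not_trace_progressions` / `not_windowTracePrime2_progressions` /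
    `not_windowTracePrime2_progression` / `not_windowTraceArch_progressions`: NO FINITE UNION OF
    ARITHMETIC PROGRESSIONS `γ(j,n) = α_j n + β_j` (any `J`, slopes `α_j ≠ 0`, shifts) is a witness,
    for the crux window AND for the archimedean rung. Engine: `tsum_lineSample` = POISSON SUMMATION
    glued to `weilMellin` (via the tree's `weilMellin_inversion`):
    `Σ_{n∈ℤ} ĝ(1/2 + i(αn+β)) = (2π/α) Σ_{k∈ℤ} e^{2πikβ/α} g(2πk/α)` — a lattice sees only the point
    values of `g` on the dual lattice (this IS the aliasing formula the route's chirped-lattice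
    ansatz needs, in the un-chirped case) — against `weilFunctional_bumpC_re_pos`: `Re W(g) ≥
    e^{-d/2}∫g > 0` for every non-negative bump supported in `[c, d] ⊆ [1/2, ∞)` off `{log n}`
    (Bombieri's form of the archimedean term; `2 sinh t ≥ 1` there). So `W` restricted to any
    prime-free subinterval of `[1/2, A]` is a genuinely absolutely-continuous positive density that
    unit atoms on finitely many lattices cannot produce: the witness must be APERIODIC at every scale.
* (W) LOCAL COUNTING LAW FOR WITNESSES (the "Weyl law" items of the earlier (N) list, now
  theorems; engine: the SHIFTED IDENTITY `hasSum_norm_sq_shift`: `Σ_i |φ̂(γ_i − T)|² = Re W(k_T)`,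
  `k_T(t) = (φ⋆φ̃)(t) e^{−iTt}` (`modulate`, `weilMellin_modulate`: modulation = vertical shift)):
  - UPPER: `re_weilFunctional_modulate_le`: `Re W(k_T) ≤ (M₀/2π) log(3+|T|) + C` (polar and prime
    terms `T`-uniformly bounded: `norm_weilPolarTerm_modulate_le`, `norm_weilPrimeTerm_modulate_le`;
    archimedean integral against `|Re ψ(1/4+iτ/2)| ≤ log(3+|τ|)+12`, `archIntegral_modulate_le`);
    hence `ncard_near_le`: EVERY witness of ANY window has `#{i : |γ_i − T| ≤ 1} ≤ C₁ log(3+|T|) + C₂`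
    with constants from one bump of radius `min(A/2,1)` — uniform in the window, i.e. exactly the
    estimate the support item `WindowCompactness` (11197) needs (proved here, negative lane).
  - LOWER: `archIntegral_modulate_ge` / `re_weilFunctional_modulate_ge` (Stirling on the near
    window, `abs_re_digamma_vertical_sub_log_le`): `Re W(k_T) ≥ (m_R/3π) log T − C'`, so
    `Re W(k_T) → +∞`; against `re_weilFunctional_modulate_le_of_ncard_le` (bounded local counts ⇒
    `Re W(k_T)` bounded, by regrouping `sum_inv_one_add_sq_le` over integer parts) this gives
    `not_trace_of_ncard_le`: NO WITNESS HAS BOUNDED LOCAL COUNTS — no uniformly discrete family,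
    no finite union of lattices or separated sequences, no zero set of a sine-type / Paley–Wiener
    function, nothing with `N(T) = O(T)` (ideator-1's (B4) made formal); witnesses cluster:
    `sup_T #{i : |γ_i − T| ≤ 1} = ∞` (indeed `≳ log T` along `T → ∞`).
* (N) NOT REFUTED, NOT ATTEMPTED FORMALLY (paper status, for provers and the next cycle):
  - the full Weyl law `N(T) = (T/π) log(T/2πe) + O(log T)` with the exact constant (the pieces
    above give `N(T) = O(T log T)` and unbounded clustering; the exact density needs Plancherel
    `∫|φ̂|² = 2π‖φ‖²` and a Tauberian step): `#{i : |γ_i| ≤ T} = (T/π) log(T/2πe) + O_A(log T)` (pair the identity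
    with modulated narrow bumps; Landau-type necessary density for UNIT masses `≥ A/2π`). Deferred.
  - one-sided families (`γ_i ≥ 0`), evenness `W(g(−·)) = W(g)` (so `−γ` is a witness with `γ`).
  - `WindowTracePrime2 → RH` / `→ SpectralThesis` (route kill criterion (ii)) is NOT expected: the
    window problem is indeterminate (e.g. `(2π/L)ℤ` and a shifted copy have equal transforms on
    `(−A, A)` for `L > A`), so one rung cannot pin the zeta ordinates. Open either way.
* (C) CONSEQUENCE recorded by earlier seats (not re-proved here): crux ⇒ `WeilPositivityOn (log 3/2)`
  (first-prime Weil positivity, OPEN; tree has only `a ≤ log 2/2`), so the crux is not cheaply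
  provable either: its content = open positivity at `L = log 3` + unit-mass crystallisation.
-/

noncomputable section

open Complex Filter Set MeasureTheory
open scoped Real Topology FourierTransform ArithmeticFunction.vonMangoldt ContDiff

set_option linter.dupNamespace false

namespace Summit.RiemannHypothesis.RiemannHypothesis.Cruxes.WindowTracePrime2.Disproof

open Literature.NumberTheory.LFunctions
open Literature.NumberTheory.LFunctions.ZetaZeros
open Summit.RiemannHypothesis.RiemannHypothesis.Theses.SpectralTrace

/-! ## The window predicate; finite families are impossible -/

/-- The window-trace predicate of level `A` for a given real family `γ : ι → ℝ`:
`Σ_i ĝ(1/2 + iγ_i) = W(g)` (as a `HasSum`) for every Weil test `g` supported in `[-A, A]`. -/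
def Trace (A : ℝ) (ι : Type) (γ : ι → ℝ) : Prop :=
  ∀ g : ℝ → ℂ, IsWeilTest g → tsupport g ⊆ Set.Icc (-A) A →
    HasSum (fun i => weilMellin g (1 / 2 + (γ i : ℂ) * Complex.I)) (weilFunctional g)

/-- The crux is `∃ ι γ, Trace (log 3) ι γ`, by `Iff.rfl`. -/
theorem windowTracePrime2_iff :
    WindowTracePrime2 ↔ ∃ (ι : Type) (γ : ι → ℝ), Trace (Real.log 3) ι γ :=
  Iff.rfl

/-- `|ĝ(1/2 + iγ)| ≤ ∫ |g|` (the summand is a Fourier transform). -/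
theorem norm_weilMellin_line_le (g : ℝ → ℂ) (γ : ℝ) :
    ‖weilMellin g (1 / 2 + (γ : ℂ) * Complex.I)‖ ≤ ∫ t, ‖g t‖ := by
  unfold weilMellin
  refine (norm_integral_le_integral_norm _).trans (le_of_eq ?_)
  congr 1 with t
  have : (1 / 2 + (γ : ℂ) * Complex.I - 1 / 2) * (t : ℂ) = ((γ * t : ℝ) : ℂ) * Complex.I := by
    push_cast; ring
  rw [norm_mul, this, Complex.norm_exp_ofReal_mul_I, mul_one]

/-- AM–GM on the support: `∫ |g| ≤ a + (∫ |g|²)/2` for a test `g` supported in `[-a, a]`. -/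
theorem integral_norm_le_of_tsupport {g : ℝ → ℂ} (hg : IsWeilTest g) {a : ℝ} (ha : 0 ≤ a)
    (hsupp : tsupport g ⊆ Set.Icc (-a) a) :
    ∫ t, ‖g t‖ ≤ a + (∫ t, ‖g t‖ ^ 2) / 2 := by
  have hpt : ∀ t, ‖g t‖ ≤ ((Set.Icc (-a) a).indicator (fun _ => (1 : ℝ)) t + ‖g t‖ ^ 2) / 2 := by
    intro t
    by_cases ht : t ∈ Set.Icc (-a) a
    · rw [Set.indicator_of_mem ht]
      nlinarith [sq_nonneg (‖g t‖ - 1), norm_nonneg (g t)]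
    · have h0 : g t = 0 := image_eq_zero_of_notMem_tsupport fun h => ht (hsupp h)
      simp [h0, Set.indicator_of_notMem ht]
  have hc : Continuous fun t => ‖g t‖ := hg.1.continuous.norm
  have hint1 : Integrable fun t => ‖g t‖ := hc.integrable_of_hasCompactSupport hg.2.norm
  have hcs2 : HasCompactSupport fun t => ‖g t‖ ^ 2 :=
    hg.2.norm.comp_left (g := fun x : ℝ => x ^ 2) (zero_pow two_ne_zero)
  have hint2 : Integrable fun t => ‖g t‖ ^ 2 := (hc.pow 2).integrable_of_hasCompactSupport hcs2
  have hint0 : Integrable fun t => (Set.Icc (-a) a).indicator (fun _ => (1 : ℝ)) t :=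
    (integrable_indicator_iff measurableSet_Icc).2
      (integrableOn_const (by rw [Real.volume_Icc]; exact ENNReal.ofReal_ne_top))
  calc ∫ t, ‖g t‖ ≤ ∫ t, ((Set.Icc (-a) a).indicator (fun _ => (1 : ℝ)) t + ‖g t‖ ^ 2) / 2 :=
        integral_mono hint1 ((hint0.add hint2).div_const 2) hpt
    _ = a + (∫ t, ‖g t‖ ^ 2) / 2 := by
        rw [integral_div, integral_add hint0 hint2, integral_indicator_const _ measurableSet_Icc,
          Real.volume_real_Icc_of_le (by linarith), smul_eq_mul, mul_one]
        ring

/-- **No finite family realises any window `A > 0`** (refutes the natural strengthening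
"finitely many quasi-zeros suffice at level `A`"; equivalently every witness of the crux is an
INFINITE family). Proof: Bombieri's coercivity `Re W(g ⋆ g̃) ≥ (N+1)‖g‖₂²` for tests of small
enough support `[-a, a]` (`weilQuadratic_coercive`, Thm. 12, in tree) against the window identity
for `k = g ⋆ g̃` (`tsupport k ⊆ [-2a, 2a] ⊆ [-A, A]`), whose zero side is
`Σ_{i ≤ N} |ĝ(1/2+iγ_i)|² ≤ N (∫|g|)² ≤ N` when `∫|g|² = 1`, `a ≤ 1/2`. [cite: Bombieri2000Weil, §12 Thm. 12] -/
theorem not_trace_of_finite {A : ℝ} (hA : 0 < A) {ι : Type} [Finite ι] (γ : ι → ℝ) :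
    ¬ Trace A ι γ := by
  intro hT
  have := Fintype.ofFinite ι
  set N : ℕ := Fintype.card ι with hN
  obtain ⟨a₀, ha₀, hco⟩ := weilQuadratic_coercive ((N : ℝ) + 1)
  set a : ℝ := min a₀ (min (A / 2) (1 / 2)) with ha_def
  have ha : 0 < a := lt_min ha₀ (lt_min (by linarith) (by norm_num))
  have haa₀ : a ≤ a₀ := min_le_left _ _
  have haA : a ≤ A / 2 := (min_le_right _ _).trans (min_le_left _ _)
  have ha2 : a ≤ 1 / 2 := (min_le_right _ _).trans (min_le_right _ _)
  obtain ⟨g, hg, hsupp, hnorm⟩ := exists_isWeilTest_sphere ha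
  have hk : IsWeilTest (weilConv g (weilReflect g)) := hg.weilConv hg.weilReflect
  have hksupp : tsupport (weilConv g (weilReflect g)) ⊆ Set.Icc (-A) A :=
    (tsupport_weilConv_weilReflect_subset hg.2 hsupp).trans
      (Set.Icc_subset_Icc (by linarith) (by linarith))
  have hsum := hT _ hk hksupp
  have hQ : weilQuadratic g =
      ∑ i, weilMellin (weilConv g (weilReflect g)) (1 / 2 + (γ i : ℂ) * Complex.I) :=
    hsum.unique (hasSum_fintype _)
  have hre : (weilQuadratic g).re = ∑ i, ‖weilMellin g (1 / 2 + (γ i : ℂ) * Complex.I)‖ ^ 2 := by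
    rw [hQ, Complex.re_sum]
    refine Finset.sum_congr rfl fun i _ => ?_
    rw [weilMellin_weilQuadratic_of_re_eq hg (by simp), Complex.ofReal_re, Complex.normSq_eq_norm_sq]
  have hL1 : ∫ t, ‖g t‖ ≤ 1 := by
    have := integral_norm_le_of_tsupport hg ha.le hsupp
    rw [hnorm] at this
    linarith
  have hterm : ∀ i, ‖weilMellin g (1 / 2 + (γ i : ℂ) * Complex.I)‖ ^ 2 ≤ 1 := fun i => by
    have h1 := (norm_weilMellin_line_le g (γ i)).trans hL1
    have h0 := norm_nonneg (weilMellin g (1 / 2 + (γ i : ℂ) * Complex.I))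
    nlinarith
  have hup : (weilQuadratic g).re ≤ N := by
    rw [hre]
    calc ∑ i, ‖weilMellin g (1 / 2 + (γ i : ℂ) * Complex.I)‖ ^ 2
        ≤ ∑ _i : ι, (1 : ℝ) := Finset.sum_le_sum fun i _ => hterm i
      _ = N := by simp [hN]
  have hlow : ((N : ℝ) + 1) * ∫ t, ‖g t‖ ^ 2 ≤ (weilQuadratic g).re := hco a ha haa₀ g hg hsupp
  rw [hnorm, mul_one] at hlow
  linarith

/-- Every witness of a window trace (any level `A > 0`) is an infinite family. -/
theorem infinite_of_trace {A : ℝ} (hA : 0 < A) {ι : Type} {γ : ι → ℝ} (h : Trace A ι γ) :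
    Infinite ι :=
  not_finite_iff_infinite.1 fun _ => not_trace_of_finite hA γ h

/-- In particular the EMPTY family is no witness (the `∃` of the crux has no junk inhabitant):
`W ≢ 0` on the tests of any window. -/
theorem not_trace_of_isEmpty {A : ℝ} (hA : 0 < A) {ι : Type} [IsEmpty ι] (γ : ι → ℝ) :
    ¬ Trace A ι γ :=
  not_trace_of_finite hA γ

/-- The finite-family strengthening of the crux is FALSE. -/
theorem not_windowTracePrime2_finite :
    ¬ ∃ (ι : Type) (_ : Finite ι) (γ : ι → ℝ), Trace (Real.log 3) ι γ := by
  rintro ⟨ι, _, γ, h⟩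
  exact not_trace_of_finite (Real.log_pos (by norm_num)) γ h

/-! ## Load-bearing: `IsWeilTest` -/

/-- The crux with the hypothesis `IsWeilTest g` DROPPED (all functions supported in the window). -/
def WindowTracePrime2WithoutIsWeilTest : Prop :=
  ∃ (ι : Type) (γ : ι → ℝ), ∀ g : ℝ → ℂ,
    tsupport g ⊆ Set.Icc (-Real.log 3) (Real.log 3) →
      HasSum (fun i => weilMellin g (1 / 2 + (γ i : ℂ) * Complex.I)) (weilFunctional g)

/-- The spike `𝟙_{{0}}`: zero almost everywhere, but `g 0 = 1`. -/
def spike : ℝ → ℂ := Set.indicator {0} (fun _ => 1)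

theorem spike_zero : spike 0 = 1 := by simp [spike]

theorem spike_of_ne {t : ℝ} (ht : t ≠ 0) : spike t = 0 := by
  simp [spike, ht]

theorem tsupport_spike : tsupport spike ⊆ Set.Icc (-Real.log 3) (Real.log 3) := by
  refine (closure_mono (Set.support_indicator_subset)).trans ?_
  rw [closure_singleton, Set.singleton_subset_iff, Set.mem_Icc]
  have h : 0 ≤ Real.log 3 := Real.log_nonneg (by norm_num)
  exact ⟨by linarith, h⟩

theorem weilMellin_spike (s : ℂ) : weilMellin spike s = 0 := by
  unfold weilMellin
  refine integral_eq_zero_of_ae ?_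
  have h0 : volume ({0} : Set ℝ) = 0 := measure_singleton 0
  filter_upwards [measure_eq_zero_iff_ae_notMem.1 h0] with t ht
  rw [spike_of_ne ht, zero_mul, Pi.zero_apply]

theorem weilPolarTerm_spike : weilPolarTerm spike = 0 := by
  simp [weilPolarTerm, weilMellin_spike]

theorem weilArchTerm_spike : weilArchTerm spike = -(Real.log π : ℂ) := by
  simp [weilArchTerm, weilArchIntegral, weilMellin_spike, spike_zero]

theorem weilPrimeTerm_spike : weilPrimeTerm spike = 0 := by
  unfold weilPrimeTerm
  refine (tsum_congr fun n => ?_).trans tsum_zero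
  rcases Nat.lt_or_ge n 2 with hn | hn
  · interval_cases n <;> simp
  · have hn' : (2 : ℝ) ≤ n := by exact_mod_cast hn
    have hlog : 0 < Real.log n := Real.log_pos (by linarith)
    rw [spike_of_ne hlog.ne', spike_of_ne (by linarith : -Real.log n ≠ 0)]
    simp

theorem weilFunctional_spike : weilFunctional spike = -(Real.log π : ℂ) := by
  simp [weilFunctional, weilPolarTerm_spike, weilArchTerm_spike, weilPrimeTerm_spike]

/-- LOAD-BEARING: `IsWeilTest` cannot be dropped. Witness `g = 𝟙_{{0}}` (supported in the
window, zero a.e.): every `ĝ(1/2+iγ)` is `0`, but `W(g) = -g(0) log π = -log π ≠ 0`, so no family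
(real or not) has `HasSum (fun i => ĝ(1/2+iγ_i)) (W g)`. Any proof must use smoothness/continuity
of the tests (pointwise values `g 0`, `g (± log 2)` enter `W`). [folklore] -/
theorem windowTracePrime2_false_without_IsWeilTest : ¬ WindowTracePrime2WithoutIsWeilTest := by
  rintro ⟨ι, γ, h⟩
  have hs := h spike tsupport_spike
  simp only [weilMellin_spike, weilFunctional_spike] at hs
  have h0 : (-(Real.log π : ℂ)) = 0 := hs.unique hasSum_zero
  have hπ : 0 < Real.log π := Real.log_pos (by linarith [Real.pi_gt_three])
  have : (Real.log π : ℂ) = 0 := neg_eq_zero.1 h0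
  exact hπ.ne' (by exact_mod_cast this)

/-! ## Resistance: the explicit formula as a complex trace; RH ⇒ crux; window-less variant ↔ RH -/


/-- The non-trivial zeros of `ζ` COUNTED WITH MULTIPLICITY: index `⟨ρ, k⟩`, `k < m(ρ)`. -/
def ZeroIdx : Type :=
  Σ ρ : riemannZetaNontrivialZeros, Fin (riemannZetaZeroOrder (ρ : ℂ)).toNat

/-- The zero carried by an index. -/
def zeroOf (i : ZeroIdx) : ℂ := (i.1 : ℂ)

theorem order_toNat_cast (ρ : riemannZetaNontrivialZeros) :
    (((riemannZetaZeroOrder (ρ : ℂ)).toNat : ℕ) : ℤ) = riemannZetaZeroOrder (ρ : ℂ) :=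
  Int.toNat_of_nonneg (riemannZetaZeroOrder_nonneg (riemannZetaNontrivialZeros.ne_one ρ.2))

/-- **The explicit formula as an unconditional COMPLEX trace**: over the non-trivial zeros with
multiplicity, `Σ_i ĝ(ρ_i) = W(g)` as an (absolutely convergent) `HasSum`, for every Weil test `g`
(`explicit_formula_holds` + `summable_norm_zeroSide`, in tree). Dropping "`γ` real" from the crux
therefore makes it a THEOREM: realness of the family is the entire content. [cite: Bombieri2000Weil, §2 Thm. 2] -/
theorem hasSum_zeros {g : ℝ → ℂ} (hg : IsWeilTest g) :
    HasSum (fun i : ZeroIdx => weilMellin g (zeroOf i)) (weilFunctional g) := by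
  have hS := summable_norm_zeroSide hg
  have hnn : ∀ ρ : riemannZetaNontrivialZeros, (0 : ℝ) ≤ riemannZetaZeroOrder (ρ : ℂ) := fun ρ => by
    exact_mod_cast riemannZetaZeroOrder_nonneg (riemannZetaNontrivialZeros.ne_one ρ.2)
  have hcastR : ∀ ρ : riemannZetaNontrivialZeros,
      (((riemannZetaZeroOrder (ρ : ℂ)).toNat : ℕ) : ℝ) = (riemannZetaZeroOrder (ρ : ℂ) : ℝ) := fun ρ => by
    exact_mod_cast order_toNat_cast ρ
  have hcastC : ∀ ρ : riemannZetaNontrivialZeros,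
      (((riemannZetaZeroOrder (ρ : ℂ)).toNat : ℕ) : ℂ) = (riemannZetaZeroOrder (ρ : ℂ) : ℂ) := fun ρ => by
    exact_mod_cast order_toNat_cast ρ
  -- absolute summability over the index with multiplicity
  have h1 : Summable fun i : ZeroIdx => ‖weilMellin g (zeroOf i)‖ := by
    refine (summable_sigma_of_nonneg fun _ => norm_nonneg _).2 ⟨fun ρ => ?_, ?_⟩
    · exact (hasSum_fintype _).summable
    · simp only [zeroOf, tsum_fintype, Finset.sum_const, Finset.card_univ, Fintype.card_fin,
        nsmul_eq_mul]
      refine hS.congr fun ρ => ?_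
      rw [norm_mul, Complex.norm_intCast, abs_of_nonneg (hnn ρ), hcastR]
  have h2 : HasSum (fun i : ZeroIdx => weilMellin g (zeroOf i)) (∑' i, weilMellin g (zeroOf i)) :=
    h1.of_norm.hasSum
  -- regroup fibrewise: Σ_ρ m(ρ) ĝ(ρ) has the same sum
  have h3 : HasSum (fun ρ : riemannZetaNontrivialZeros =>
      (riemannZetaZeroOrder (ρ : ℂ) : ℂ) * weilMellin g ρ) (∑' i, weilMellin g (zeroOf i)) := by
    have h := h2.sigma fun ρ => hasSum_fintype _
    refine h.congr_fun ?_
    intro ρ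
    simp only [zeroOf, Finset.sum_const, Finset.card_univ, Fintype.card_fin, nsmul_eq_mul, hcastC]
  -- and that sum is `W(g)` by the explicit formula (uniqueness of the symmetric limit)
  have hZ : HasWeilZeroSide g
      (∑' ρ : riemannZetaNontrivialZeros, (riemannZetaZeroOrder (ρ : ℂ) : ℂ) * weilMellin g ρ) :=
    hasWeilZeroSide_tsum hS
  have hW : HasWeilZeroSide g (weilFunctional g) := explicit_formula_holds hg
  have hZW := tendsto_nhds_unique hZ hW
  have hS' : (∑' i, weilMellin g (zeroOf i)) = weilFunctional g := by
    rw [← h3.tsum_eq]; exact hZW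
  exact hS' ▸ h2

/-- The crux with "`γ : ι → ℝ`" weakened to "`ρ : ι → ℂ`" (atoms anywhere, not on the line). -/
def WindowTracePrime2WithoutReal : Prop :=
  ∃ (ι : Type) (ρ : ι → ℂ), ∀ g : ℝ → ℂ, IsWeilTest g →
    tsupport g ⊆ Set.Icc (-Real.log 3) (Real.log 3) →
      HasSum (fun i => weilMellin g (ρ i)) (weilFunctional g)

/-- LOAD-BEARING (in the provable direction): without realness the crux is a THEOREM
(witness: the zeta zeros with multiplicity) — so "γ real" carries all the difficulty. -/
theorem windowTracePrime2WithoutReal_holds : WindowTracePrime2WithoutReal :=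
  ⟨ZeroIdx, zeroOf, fun _ hg _ => hasSum_zeros hg⟩

/-- Under RH every non-trivial zero is `1/2 + i·Im ρ`. -/
theorem zeroOf_eq_of_riemannHypothesis (hRH : _root_.RiemannHypothesis) (i : ZeroIdx) :
    (1 / 2 : ℂ) + ((zeroOf i).im : ℂ) * Complex.I = zeroOf i := by
  obtain ⟨⟨ρ, hρ⟩, k⟩ := i
  have hre : ρ.re = 1 / 2 := by
    refine hRH ρ (riemannZetaNontrivialZeros.zeta_eq_zero hρ) ?_ (riemannZetaNontrivialZeros.ne_one hρ)
    rintro ⟨n, rfl⟩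
    have h := riemannZetaNontrivialZeros.re_pos hρ
    simp at h
    linarith
  apply Complex.ext <;> simp [zeroOf, hre]

/-- **RESISTANCE**: RH ⇒ the zeta ordinates (with multiplicity) realise EVERY window — in
particular the crux. Hence any disproof of `WindowTracePrime2` is a disproof of RH. -/
theorem trace_of_riemannHypothesis (hRH : _root_.RiemannHypothesis) (A : ℝ) :
    Trace A ZeroIdx (fun i => (zeroOf i).im) := by
  intro g hg _
  simpa only [zeroOf_eq_of_riemannHypothesis hRH] using hasSum_zeros hg

theorem windowTracePrime2_of_riemannHypothesis (hRH : _root_.RiemannHypothesis) :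
    WindowTracePrime2 :=
  ⟨ZeroIdx, fun i => (zeroOf i).im, trace_of_riemannHypothesis hRH (Real.log 3)⟩

/-- Contrapositive: a kill of the crux refutes the Riemann hypothesis (and the summit). -/
theorem not_riemannHypothesis_of_not_windowTracePrime2 (h : ¬ WindowTracePrime2) :
    ¬ _root_.RiemannHypothesis :=
  fun hRH => h (windowTracePrime2_of_riemannHypothesis hRH)

/-- The crux with the WINDOW hypothesis dropped is thesis X (`SpectralThesis`) verbatim. -/
theorem windowTracePrime2WithoutWindow_iff_spectralThesis :
    (∃ (ι : Type) (γ : ι → ℝ), ∀ g : ℝ → ℂ, IsWeilTest g →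
      HasSum (fun i => weilMellin g (1 / 2 + (γ i : ℂ) * Complex.I)) (weilFunctional g)) ↔
    SpectralThesis :=
  Iff.rfl

/-- X ⇒ Weil positivity: for `k = h ⋆ h̃`, `k̂(1/2+iγ) = |ĥ(1/2+iγ)|² ≥ 0`, and a `HasSum` of
non-negative reals is non-negative. -/
theorem weilPositivity_of_spectralThesis (hX : SpectralThesis) : WeilPositivity := by
  obtain ⟨ι, γ, h⟩ := hX
  intro g hg
  have hk := h _ (hg.weilConv hg.weilReflect)
  have hre := Complex.hasSum_re hk
  refine hre.nonneg fun i => ?_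
  show 0 ≤ (weilMellin (weilConv g (weilReflect g)) (1 / 2 + (γ i : ℂ) * Complex.I)).re
  rw [weilMellin_weilQuadratic_of_re_eq hg (by simp), Complex.ofReal_re]
  exact Complex.normSq_nonneg _

/-- LOAD-BEARING (in the unprovable direction): dropping the window gives a statement
EQUIVALENT to RH (`weil_criterion_holds`, `explicit_formula_holds` in tree), so no
`_false_without_window` theorem can exist short of `¬RH`, and no proof short of RH. -/
theorem windowTracePrime2WithoutWindow_iff_riemannHypothesis :
    SpectralThesis ↔ _root_.RiemannHypothesis :=
  ⟨fun hX => weil_criterion_holds.2 (weilPositivity_of_spectralThesis hX),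
    fun hRH => ⟨ZeroIdx, fun i => (zeroOf i).im, fun g hg => by
      simpa only [zeroOf_eq_of_riemannHypothesis hRH] using hasSum_zeros hg⟩⟩

/-! ## Boundary, monotonicity, local finiteness -/


/-! ### Boundary of the window parameter -/

/-- `W(0) = 0`. -/
theorem weilFunctional_zero : weilFunctional 0 = 0 := by
  simp [weilFunctional, weilPolarTerm, weilPrimeTerm, weilArchTerm, weilArchIntegral]

/-- BOUNDARY (junk region of the parameter): for `A ≤ 0` the only test in the window is `0`, and
the EMPTY family realises `Trace A` — the `∃` of a window statement is junk-inhabited exactly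
when `A ≤ 0` (compare `not_trace_of_isEmpty` for `A > 0`). The crux has `A = log 3 > 0`. -/
theorem trace_of_nonpos {A : ℝ} (hA : A ≤ 0) (ι : Type) [IsEmpty ι] (γ : ι → ℝ) : Trace A ι γ := by
  intro g hg hsupp
  rw [hg.eq_zero_of_tsupport_subset hsupp hA, weilFunctional_zero]
  simp

/-- MONOTONICITY: a family realising the window `B` realises every smaller window. In
particular `WindowTracePrime2 → WindowTraceArch` (`log 2 ≤ log 3`): the crux implies its
declared dependency. -/
theorem Trace.anti {A B : ℝ} (hAB : A ≤ B) {ι : Type} {γ : ι → ℝ} (h : Trace B ι γ) : Trace A ι γ :=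
  fun g hg hsupp => h g hg (hsupp.trans (Set.Icc_subset_Icc (neg_le_neg hAB) hAB))

theorem windowTraceArch_of_windowTracePrime2 (h : WindowTracePrime2) : WindowTraceArch := by
  obtain ⟨ι, γ, hγ⟩ := h
  have hlog : Real.log 2 ≤ Real.log 3 := Real.log_le_log (by norm_num) (by norm_num)
  exact ⟨ι, γ, Trace.anti hlog hγ⟩

theorem windowTracePrime2_of_spectralThesis (h : SpectralThesis) : WindowTracePrime2 := by
  obtain ⟨ι, γ, hγ⟩ := h
  exact ⟨ι, γ, fun g hg _ => hγ g hg⟩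

/-- SYMMETRY: `W` is even (`weilFunctional_comp_neg`, hypothesis-free in the tree), so the
reflected family `-γ` realises the same window. Witnesses come in `±` pairs; there is no
chirality (sign) constraint to exploit, and one may symmetrise the SEARCH (not the family). -/
theorem Trace.neg {A : ℝ} {ι : Type} {γ : ι → ℝ} (h : Trace A ι γ) : Trace A ι (fun i => -γ i) := by
  intro g hg hsupp
  have hg' : IsWeilTest (fun t => g (-t)) := hg.comp_neg
  have hsupp' : tsupport (fun t => g (-t)) ⊆ Set.Icc (-A) A := by
    intro x hx
    have e : (fun t => g (-t)) = g ∘ (Homeomorph.neg ℝ) := rfl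
    rw [e, tsupport_comp_eq_preimage] at hx
    have hx' : -x ∈ tsupport g := by simpa using hx
    have := hsupp hx'
    simp only [Set.mem_Icc] at this ⊢
    constructor <;> linarith [this.1, this.2]
  have hs := h _ hg' hsupp'
  rw [weilFunctional_comp_neg] at hs
  convert hs using 2 with i
  rw [weilMellin_comp_neg]
  congr 1
  push_cast
  ring

/-- Hence the reflected crux family is again a witness. -/
theorem windowTracePrime2_neg_iff {ι : Type} (γ : ι → ℝ) :
    Trace (Real.log 3) ι (fun i => -γ i) ↔ Trace (Real.log 3) ι γ :=
  ⟨fun h => by simpa using h.neg, fun h => h.neg⟩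

/-! ### Local finiteness of every witness -/

/-- Lower bound for the Fourier transform of a non-negative bump at low frequencies:
if `|γ|·r_out ≤ 1` then `Re b̂(1/2+iγ) ≥ cos 1 · ∫ b`. -/
theorem re_weilMellin_bump_ge (b : ContDiffBump (0 : ℝ)) {γ : ℝ} (hγ : |γ| * b.rOut ≤ 1) :
    Real.cos 1 * ∫ t, b t ≤ (weilMellin (fun t => (b t : ℂ)) (1 / 2 + (γ : ℂ) * Complex.I)).re := by
  have hexp : ∀ t : ℝ, (1 / 2 + (γ : ℂ) * Complex.I - 1 / 2) * (t : ℂ) = ((γ * t : ℝ) : ℂ) * Complex.I :=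
    fun t => by push_cast; ring
  have hint : Integrable fun t : ℝ =>
      (b t : ℂ) * cexp ((1 / 2 + (γ : ℂ) * Complex.I - 1 / 2) * (t : ℂ)) := by
    refine Continuous.integrable_of_hasCompactSupport ?_ ?_
    · exact (Complex.continuous_ofReal.comp b.continuous).mul (by fun_prop)
    · exact (b.hasCompactSupport.comp_left Complex.ofReal_zero).mul_right
  have hre : ∀ t : ℝ, ((b t : ℂ) * cexp ((1 / 2 + (γ : ℂ) * Complex.I - 1 / 2) * (t : ℂ))).re =
      b t * Real.cos (γ * t) := by
    intro t
    rw [hexp, Complex.re_ofReal_mul, Complex.exp_ofReal_mul_I_re]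
  unfold weilMellin
  rw [← RCLike.re_to_complex, ← integral_re hint]
  simp only [RCLike.re_to_complex, hre]
  rw [← integral_const_mul]
  refine integral_mono ?_ ?_ fun t => ?_
  · exact (b.continuous.const_mul _).integrable_of_hasCompactSupport b.hasCompactSupport.mul_left
  · exact (b.continuous.mul (by fun_prop)).integrable_of_hasCompactSupport
      b.hasCompactSupport.mul_right
  · show Real.cos 1 * b t ≤ b t * Real.cos (γ * t)
    by_cases ht : t ∈ tsupport b
    · rw [b.tsupport_eq, Metric.mem_closedBall, dist_zero_right, Real.norm_eq_abs] at ht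
      have h1 : |γ * t| ≤ 1 := by
        rw [abs_mul]
        calc |γ| * |t| ≤ |γ| * b.rOut := by gcongr
          _ ≤ 1 := hγ
      have hcos : Real.cos 1 ≤ Real.cos (γ * t) := by
        rw [← Real.cos_abs (γ * t)]
        exact Real.cos_le_cos_of_nonneg_of_le_pi (abs_nonneg _) (by linarith [Real.pi_gt_three]) h1
      nlinarith [b.nonneg (x := t)]
    · rw [image_eq_zero_of_notMem_tsupport ht]
      simp

/-- **LOCAL FINITENESS of every witness**: if `γ` realises some window `A > 0` then only
finitely many `γ_i` lie in any bounded set. (Test the identity on `k = g ⋆ g̃`, `g` a narrow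
non-negative bump: `Σ_i |ĝ(1/2+iγ_i)|²` converges, and `|ĝ(1/2+iγ)| ≥ cos 1 · ∫ g > 0` for
`|γ| ≤ K`.) Consequences: bounded families, families with a finite accumulation point, and
families repeating one value infinitely often (infinite multiplicity) are all excluded; the
multiplicities `#{i | γ_i = x}` are finite. -/
theorem finite_abs_le_of_trace {A : ℝ} (hA : 0 < A) {ι : Type} {γ : ι → ℝ} (h : Trace A ι γ)
    (K : ℝ) : {i : ι | |γ i| ≤ K}.Finite := by
  -- a bump of radius `a` with `2a ≤ A` and `(|K|+1) a ≤ 1`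
  set a : ℝ := min (A / 2) (1 / (|K| + 1)) with ha_def
  have hK1 : 0 < |K| + 1 := by positivity
  have ha : 0 < a := lt_min (by linarith) (by positivity)
  have haA : a ≤ A / 2 := min_le_left _ _
  have haK : a ≤ 1 / (|K| + 1) := min_le_right _ _
  let b : ContDiffBump (0 : ℝ) := ⟨a / 2, a, by positivity, by linarith⟩
  set g : ℝ → ℂ := fun t => ((b t : ℝ) : ℂ) with hg_def
  have hg : IsWeilTest g :=
    ⟨Complex.ofRealCLM.contDiff.comp b.contDiff, b.hasCompactSupport.comp_left Complex.ofReal_zero⟩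
  have hsupp : tsupport g ⊆ Set.Icc (-a) a := by
    refine (tsupport_comp_subset Complex.ofReal_zero _).trans ?_
    rw [b.tsupport_eq, Real.closedBall_eq_Icc, zero_sub, zero_add]
  have hk : IsWeilTest (weilConv g (weilReflect g)) := hg.weilConv hg.weilReflect
  have hksupp : tsupport (weilConv g (weilReflect g)) ⊆ Set.Icc (-A) A :=
    (tsupport_weilConv_weilReflect_subset hg.2 hsupp).trans
      (Set.Icc_subset_Icc (by linarith) (by linarith))
  have hsum := h _ hk hksupp
  -- the real parts `|ĝ(γ_i)|²` are summable, hence tend to `0` along `cofinite`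
  have hs : Summable fun i => ‖weilMellin g (1 / 2 + (γ i : ℂ) * Complex.I)‖ ^ 2 := by
    refine (Complex.hasSum_re hsum).summable.congr fun i => ?_
    show (weilMellin (weilConv g (weilReflect g)) (1 / 2 + (γ i : ℂ) * Complex.I)).re = _
    rw [weilMellin_weilQuadratic_of_re_eq hg (by simp), Complex.ofReal_re, Complex.normSq_eq_norm_sq]
  set c₀ : ℝ := Real.cos 1 * ∫ t, b t with hc₀
  have hcos : 0 < Real.cos 1 := Real.cos_pos_of_mem_Ioo ⟨by linarith [Real.pi_gt_three],
    by linarith [Real.pi_gt_three]⟩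
  have hc₀pos : 0 < c₀ := mul_pos hcos b.integral_pos
  have hev := hs.tendsto_cofinite_zero.eventually (gt_mem_nhds (sq_pos_of_pos hc₀pos))
  refine (Filter.eventually_cofinite.1 hev).subset fun i hi => ?_
  -- for `|γ_i| ≤ K`: `‖ĝ(γ_i)‖² ≥ c₀²`
  simp only [Set.mem_setOf_eq, not_lt]
  have hγ : |γ i| * b.rOut ≤ 1 := by
    show |γ i| * a ≤ 1
    calc |γ i| * a ≤ (|K| + 1) * (1 / (|K| + 1)) := by
          gcongr
          exact hi.trans ((le_abs_self K).trans (by linarith))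
      _ = 1 := by field_simp
  have hre := re_weilMellin_bump_ge b hγ
  have hnorm : c₀ ≤ ‖weilMellin g (1 / 2 + (γ i : ℂ) * Complex.I)‖ :=
    hre.trans (Complex.re_le_norm _)
  nlinarith

/-- BOUNDED families are excluded (every witness is unbounded). -/
theorem not_trace_of_bounded {A : ℝ} (hA : 0 < A) {ι : Type} {γ : ι → ℝ} {K : ℝ}
    (hK : ∀ i, |γ i| ≤ K) [Infinite ι] : ¬ Trace A ι γ := fun h =>
  Set.infinite_univ (α := ι) ((finite_abs_le_of_trace hA h K).subset fun i _ => hK i)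

/-- Multiplicities are finite: no value is repeated infinitely often. -/
theorem finite_fibre_of_trace {A : ℝ} (hA : 0 < A) {ι : Type} {γ : ι → ℝ} (h : Trace A ι γ)
    (x : ℝ) : {i : ι | γ i = x}.Finite :=
  (finite_abs_le_of_trace hA h |x|).subset fun i hi => by
    simp only [Set.mem_setOf_eq] at hi ⊢
    rw [hi]

/-! ## Faithfulness: only the prime 2 enters on the window -/

/-- FAITHFULNESS of the informal text ("the prime power 2 is the only arithmetic input"): for a
continuous `g` with `tsupport g ⊆ [-log 3, log 3]` the prime term of `W` is exactly the spike
`(log 2/√2)·(g(log 2) + g(-log 2))` — `g(±log 3) = 0` because the support is open, and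
`log n > log 3` for `n ≥ 4`. -/
theorem weilPrimeTerm_of_window_three {g : ℝ → ℂ} (hg : Continuous g)
    (hsupp : tsupport g ⊆ Set.Icc (-Real.log 3) (Real.log 3)) :
    weilPrimeTerm g =
      ((Real.log 2 : ℝ) : ℂ) / (Real.sqrt 2 : ℂ) * (g (Real.log 2) + g (-Real.log 2)) := by
  have hIoo : Function.support g ⊆ Set.Ioo (-Real.log 3) (Real.log 3) :=
    support_subset_Ioo_of_tsupport_subset_Icc hg hsupp
  have hzero : ∀ x : ℝ, Real.log 3 ≤ |x| → g x = 0 := by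
    intro x hx
    by_contra hne
    have hmem := hIoo (Function.mem_support.2 hne)
    rw [Set.mem_Ioo] at hmem
    have : |x| < Real.log 3 := abs_lt.2 ⟨hmem.1, hmem.2⟩
    linarith
  unfold weilPrimeTerm
  rw [tsum_eq_single 2]
  · push_cast
    rw [ArithmeticFunction.vonMangoldt_apply_prime Nat.prime_two]
    push_cast
    ring
  · intro n hn
    rcases Nat.lt_or_ge n 3 with h3 | h3
    · interval_cases n <;> simp_all
    · have hn' : (3 : ℝ) ≤ n := by exact_mod_cast h3
      have hlog : Real.log 3 ≤ Real.log n := Real.log_le_log (by norm_num) hn'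
      have hpos : 0 ≤ Real.log n := (Real.log_nonneg (by norm_num)).trans hlog
      rw [hzero _ (by rwa [abs_of_nonneg hpos]), hzero _ (by rwa [abs_neg, abs_of_nonneg hpos])]
      simp

/-- Hence on the window `[-log 3, log 3]` the functional is polar + archimedean minus the
single spike at `± log 2`. -/
theorem weilFunctional_of_window_three {g : ℝ → ℂ} (hg : Continuous g)
    (hsupp : tsupport g ⊆ Set.Icc (-Real.log 3) (Real.log 3)) :
    weilFunctional g = weilPolarTerm g -
      ((Real.log 2 : ℝ) : ℂ) / (Real.sqrt 2 : ℂ) * (g (Real.log 2) + g (-Real.log 2)) +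
        weilArchTerm g := by
  rw [weilFunctional, weilPrimeTerm_of_window_three hg hsupp]

/-! ## No finite union of arithmetic progressions is a witness (Poisson summation) -/

/-! ### Poisson summation for `ĝ` sampled along an arithmetic progression -/

/-- The summand of the crux sampled along the progression `x ↦ α x + β`:
`lineSample g α β x = ĝ(1/2 + i(αx + β))`. -/
def lineSample (g : ℝ → ℂ) (α β x : ℝ) : ℂ :=
  weilMellin g (1 / 2 + ((α * x + β : ℝ) : ℂ) * I)

theorem lineSample_eq (g : ℝ → ℂ) (α β x : ℝ) :
    lineSample g α β x = weilMellin g (((1 / 2 : ℝ) : ℂ) + ((α * x + β : ℝ) : ℂ) * I) := by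
  simp only [lineSample]
  push_cast
  ring_nf

theorem continuous_lineSample {g : ℝ → ℂ} (hg : IsWeilTest g) (α β : ℝ) :
    Continuous (lineSample g α β) := by
  have h := continuous_weilMellin_vertical hg.1.continuous hg.2 (1 / 2)
  have : lineSample g α β =
      (fun y : ℝ => weilMellin g (((1 / 2 : ℝ) : ℂ) + y * I)) ∘ fun x => α * x + β := by
    ext x
    simp only [Function.comp_apply, lineSample_eq]
  rw [this]
  exact h.comp (by fun_prop)

theorem norm_lineSample_le {g : ℝ → ℂ} (hg : IsWeilTest g) (α β x : ℝ) :
    ‖lineSample g α β x‖ ≤ weilDecayW 0 g * (1 + (α * x + β) ^ 2)⁻¹ := by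
  have h := norm_weilMellin_vertical_le hg (1 / 2) (α * x + β)
  rw [show |(1 / 2 : ℝ) - 1 / 2| = 0 by norm_num] at h
  rwa [lineSample_eq]

/-- Decay `O(|x|⁻²)` of the samples (from `‖ĝ(1/2+iy)‖ ≤ C/(1+y²)`). -/
theorem isBigO_lineSample {g : ℝ → ℂ} (hg : IsWeilTest g) {α : ℝ} (hα : α ≠ 0) (β : ℝ) :
    lineSample g α β =O[cocompact ℝ] fun x : ℝ => |x| ^ (-2 : ℝ) := by
  set C := weilDecayW 0 g with hC
  have hC0 : 0 ≤ C := weilDecayW_nonneg 0 g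
  have hαpos : 0 < |α| := abs_pos.2 hα
  refine Asymptotics.IsBigO.of_bound (C * (4 / α ^ 2)) ?_
  have hR : (Set.Icc (-(2 * |β| / |α|)) (2 * |β| / |α|))ᶜ ∈ cocompact ℝ :=
    isCompact_Icc.compl_mem_cocompact
  filter_upwards [hR] with x hx
  have hx' : 2 * |β| / |α| < |x| := by
    simp only [Set.mem_compl_iff, Set.mem_Icc, not_and_or, not_le] at hx
    have hnn : 0 ≤ 2 * |β| / |α| := by positivity
    rcases hx with h | h
    · have hneg : x < 0 := by linarith
      rw [abs_of_neg hneg]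
      linarith
    · exact lt_of_lt_of_le h (le_abs_self x)
  have hxpos : 0 < |x| := lt_of_le_of_lt (by positivity) hx'
  have hβ : 2 * |β| < |α| * |x| := by
    have := (div_lt_iff₀ hαpos).1 hx'
    linarith
  have hlow : |α| * |x| / 2 ≤ |α * x + β| := by
    have h1 : |α * x| ≤ |α * x + β| + |β| := by
      have := abs_add_le (α * x + β) (-β)
      simpa using this
    rw [abs_mul] at h1
    linarith
  have hlowpos : 0 < |α| * |x| / 2 := by positivity
  have hsq : (|α| * |x| / 2) ^ 2 ≤ (α * x + β) ^ 2 := by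
    rw [← sq_abs (α * x + β)]
    exact pow_le_pow_left₀ hlowpos.le hlow 2
  have hinv : (1 + (α * x + β) ^ 2)⁻¹ ≤ 4 / α ^ 2 * (x ^ 2)⁻¹ := by
    have h2 : (|α| * |x| / 2) ^ 2 ≤ 1 + (α * x + β) ^ 2 := by linarith
    calc (1 + (α * x + β) ^ 2)⁻¹ ≤ ((|α| * |x| / 2) ^ 2)⁻¹ := by
          exact inv_anti₀ (by positivity) h2
      _ = 4 / α ^ 2 * (x ^ 2)⁻¹ := by
          rw [show (|α| * |x| / 2) ^ 2 = α ^ 2 * x ^ 2 / 4 by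
            rw [div_pow, mul_pow, sq_abs, sq_abs]; norm_num]
          have hx0 : x ≠ 0 := abs_pos.1 hxpos
          field_simp
  have hnorm : ‖(|x| ^ (-2 : ℝ))‖ = (x ^ 2)⁻¹ := by
    rw [Real.norm_of_nonneg (Real.rpow_nonneg (abs_nonneg x) _), Real.rpow_neg (abs_nonneg x),
      show (2 : ℝ) = ((2 : ℕ) : ℝ) by norm_num, Real.rpow_natCast, sq_abs]
  rw [hnorm]
  calc ‖lineSample g α β x‖ ≤ C * (1 + (α * x + β) ^ 2)⁻¹ := norm_lineSample_le hg α β x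
    _ ≤ C * (4 / α ^ 2 * (x ^ 2)⁻¹) := mul_le_mul_of_nonneg_left hinv hC0
    _ = C * (4 / α ^ 2) * (x ^ 2)⁻¹ := by ring

/-- **The Fourier transform of the samples** (Mathlib normalisation `𝓕 f(w) = ∫ e^{-2πivw} f(v) dv`):
`𝓕(lineSample g α β)(w) = (2π/α) e^{2πiwβ/α} g(2πw/α)` for `α > 0` — substitution
`y = αv + β` and Mellin (= Fourier) inversion `∫ ĝ(1/2+iy) e^{-iyt} dy = 2π g(t)`
(`weilMellin_inversion`). -/
theorem fourier_lineSample {g : ℝ → ℂ} (hg : IsWeilTest g) {α : ℝ} (hα : 0 < α) (β w : ℝ) :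
    𝓕 (lineSample g α β) w =
      ((2 * π / α : ℝ) : ℂ) * cexp (2 * π * β * w / α * I) * g (2 * π * w / α) := by
  rw [Real.fourier_real_eq_integral_exp_smul]
  simp only [smul_eq_mul]
  set F : ℝ → ℂ := fun y =>
    cexp ((((-2) * π * ((y - β) / α) * w : ℝ) : ℂ) * I) *
      weilMellin g (((1 / 2 : ℝ) : ℂ) + (y : ℂ) * I) with hF
  have hint : (fun v : ℝ => cexp (((-2 * π * v * w : ℝ) : ℂ) * I) * lineSample g α β v) =
      fun v => F (α * v + β) := by
    have hα' : (α : ℂ) ≠ 0 := by exact_mod_cast hα.ne'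
    ext v
    simp only [hF, lineSample_eq]
    congr 3
    push_cast
    field_simp
    ring
  rw [hint]
  have h1 : ∫ v : ℝ, F (α * v + β) = |α⁻¹| • ∫ y : ℝ, F (y + β) :=
    Measure.integral_comp_mul_left (fun u => F (u + β)) α
  have h2 : ∫ y : ℝ, F (y + β) = ∫ y : ℝ, F y := integral_add_right_eq_self (fun y => F y) β
  rw [h1, h2, abs_of_pos (inv_pos.2 hα)]
  have h3 : ∀ y : ℝ, F y = cexp (2 * π * β * w / α * I) *
      (weilMellin g (((1 / 2 : ℝ) : ℂ) + (y : ℂ) * I) * cexp (-((y : ℂ) * I) * ((2 * π * w / α : ℝ) : ℂ))) := by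
    intro y
    have hα' : (α : ℂ) ≠ 0 := by exact_mod_cast hα.ne'
    have he : cexp ((((-2) * π * ((y - β) / α) * w : ℝ) : ℂ) * I) =
        cexp (2 * π * β * w / α * I) * cexp (-((y : ℂ) * I) * ((2 * π * w / α : ℝ) : ℂ)) := by
      rw [← Complex.exp_add]
      congr 1
      push_cast
      field_simp
      ring
    simp only [hF]
    rw [he]
    ring
  simp_rw [h3]
  rw [integral_const_mul, weilMellin_inversion hg (1 / 2) (2 * π * w / α)]
  rw [Complex.real_smul]
  push_cast
  ring_nf
  simp

/-- A compactly supported `g` vanishes at the lattice points `2πk/α` for all but finitely many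
`k : ℤ`. -/
theorem exists_finset_lattice_zero {g : ℝ → ℂ} (hg : HasCompactSupport g) {α : ℝ} (hα : 0 < α) :
    ∃ N : ℕ, ∀ k : ℤ, k ∉ Finset.Icc (-(N : ℤ)) N → g (2 * π * k / α) = 0 := by
  obtain ⟨R, hR⟩ := hg.isCompact.isBounded.subset_closedBall 0
  refine ⟨⌈|R| * α / (2 * π)⌉₊, fun k hk => ?_⟩
  apply image_eq_zero_of_notMem_tsupport
  intro hmem
  have h1 := hR hmem
  rw [Metric.mem_closedBall, dist_zero_right, Real.norm_eq_abs] at h1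
  have hkR : |R| * α / (2 * π) < |(k : ℝ)| := by
    simp only [Finset.mem_Icc, not_and_or, not_le] at hk
    have hceil : |R| * α / (2 * π) ≤ (⌈|R| * α / (2 * π)⌉₊ : ℝ) := Nat.le_ceil _
    rcases hk with hk | hk
    · have h' : (k : ℝ) < -(⌈|R| * α / (2 * π)⌉₊ : ℝ) := by exact_mod_cast hk
      have hN0 : (0 : ℝ) ≤ (⌈|R| * α / (2 * π)⌉₊ : ℝ) := Nat.cast_nonneg _
      have hkneg : (k : ℝ) < 0 := by linarith
      rw [abs_of_neg hkneg]
      linarith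
    · have : (⌈|R| * α / (2 * π)⌉₊ : ℝ) < (k : ℝ) := by exact_mod_cast hk
      exact lt_of_lt_of_le (hceil.trans_lt this) (le_abs_self _)
  have h2 : |2 * π * (k : ℝ) / α| = 2 * π * |(k : ℝ)| / α := by
    rw [abs_div, abs_mul, abs_of_pos (by positivity : (0 : ℝ) < 2 * π), abs_of_pos hα]
  rw [h2] at h1
  have h3 : 2 * π * |(k : ℝ)| / α > |R| := by
    rw [gt_iff_lt, lt_div_iff₀ hα]
    have := (div_lt_iff₀ (by positivity : (0 : ℝ) < 2 * π)).1 hkR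
    linarith
  linarith [le_abs_self R]

/-- The Fourier transform of the samples is summable over `ℤ` (finitely many non-zero terms). -/
theorem summable_fourier_lineSample {g : ℝ → ℂ} (hg : IsWeilTest g) {α : ℝ} (hα : 0 < α) (β : ℝ) :
    Summable fun k : ℤ => 𝓕 (lineSample g α β) k := by
  obtain ⟨N, hN⟩ := exists_finset_lattice_zero hg.2 hα
  refine summable_of_ne_finset_zero (s := Finset.Icc (-(N : ℤ)) N) fun k hk => ?_
  rw [fourier_lineSample hg hα, hN k hk, mul_zero]

/-- **Poisson summation along a progression**: for a Weil test `g`, `α > 0` and real `β`,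
`Σ_{n ∈ ℤ} ĝ(1/2 + i(αn + β)) = (2π/α) Σ_{k ∈ ℤ} e^{2πikβ/α} g(2πk/α)` — a FINITE combination of
point values of `g` at the dual lattice `(2π/α)ℤ`. (This is the `k`-aliasing formula of the
route's chirped-lattice ansatz, in the un-chirped case.) -/
theorem tsum_lineSample {g : ℝ → ℂ} (hg : IsWeilTest g) {α : ℝ} (hα : 0 < α) (β : ℝ) :
    ∑' n : ℤ, lineSample g α β n =
      ∑' k : ℤ, ((2 * π / α : ℝ) : ℂ) * cexp (2 * π * β * k / α * I) * g (2 * π * k / α) := by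
  have hP := Real.tsum_eq_tsum_fourier_of_rpow_decay_of_summable (continuous_lineSample hg α β)
    one_lt_two (isBigO_lineSample hg hα.ne' β) (summable_fourier_lineSample hg hα β) 0
  simp only [zero_add] at hP
  rw [hP]
  refine tsum_congr fun k => ?_
  rw [fourier_lineSample hg hα, fourier_coe_apply]
  simp

/-- Hence if `g` vanishes on the dual lattice `(2π/α)ℤ` the whole progression sum VANISHES. -/
theorem tsum_lineSample_eq_zero {g : ℝ → ℂ} (hg : IsWeilTest g) {α : ℝ} (hα : 0 < α) (β : ℝ)
    (h0 : ∀ k : ℤ, g (2 * π * k / α) = 0) : ∑' n : ℤ, lineSample g α β n = 0 := by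
  rw [tsum_lineSample hg hα β]
  simp [h0]

/-- The same for `α < 0` (re-index `n ↦ -n`), hence for every `α ≠ 0`. -/
theorem tsum_lineSample_eq_zero' {g : ℝ → ℂ} (hg : IsWeilTest g) {α : ℝ} (hα : α ≠ 0) (β : ℝ)
    (h0 : ∀ k : ℤ, g (2 * π * k / α) = 0) : ∑' n : ℤ, lineSample g α β n = 0 := by
  rcases hα.lt_or_gt with hneg | hpos
  · have h1 : (fun n : ℤ => lineSample g α β n) = fun n : ℤ => lineSample g (-α) β ((Equiv.neg ℤ) n) := by
      ext n
      simp only [lineSample, Equiv.neg_apply, Int.cast_neg, mul_neg, neg_mul, neg_neg]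
    rw [h1, Equiv.tsum_eq (Equiv.neg ℤ) (fun n : ℤ => lineSample g (-α) β n)]
    refine tsum_lineSample_eq_zero hg (neg_pos.2 hneg) β fun k => ?_
    have := h0 (-k)
    rw [← this]
    congr 1
    push_cast
    field_simp
  · exact tsum_lineSample_eq_zero hg hpos β h0


/-! ### `W` is strictly positive on non-negative bumps supported right of `1/2`, off the primes -/

section BumpPositivity

variable {m : ℝ} (b : ContDiffBump m)

/-- The complexified bump. -/
def bumpC (b : ContDiffBump m) : ℝ → ℂ := fun t => ((b t : ℝ) : ℂ)

theorem isWeilTest_bumpC : IsWeilTest (bumpC b) :=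
  ⟨Complex.ofRealCLM.contDiff.comp b.contDiff, b.hasCompactSupport.comp_left Complex.ofReal_zero⟩

theorem tsupport_bumpC : tsupport (bumpC b) ⊆ Set.Icc (m - b.rOut) (m + b.rOut) := by
  refine (tsupport_comp_subset Complex.ofReal_zero _).trans ?_
  rw [b.tsupport_eq, Real.closedBall_eq_Icc]

theorem bumpC_eq_zero {t : ℝ} (ht : t ∉ Set.Icc (m - b.rOut) (m + b.rOut)) : bumpC b t = 0 :=
  image_eq_zero_of_notMem_tsupport fun h => ht (tsupport_bumpC b h)

theorem bump_eq_zero {t : ℝ} (ht : t ∉ Set.Icc (m - b.rOut) (m + b.rOut)) : b t = 0 := by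
  have := bumpC_eq_zero b ht
  simpa [bumpC] using this

/-- The polar term as a real integral: `ĝ(0) + ĝ(1) = ∫ b(t)(e^{-t/2} + e^{t/2}) dt`. -/
theorem weilPolarTerm_bumpC :
    weilPolarTerm (bumpC b) = ((∫ t : ℝ, b t * (Real.exp (-t / 2) + Real.exp (t / 2)) : ℝ) : ℂ) := by
  rw [← integral_complex_ofReal]
  unfold weilPolarTerm weilMellin
  rw [← integral_add]
  · congr 1 with t
    simp only [bumpC]
    push_cast
    have e1 : cexp ((0 - 1 / 2) * (t : ℂ)) = cexp (-(t : ℂ) / 2) := by congr 1; ring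
    have e2 : cexp ((1 - 1 / 2) * (t : ℂ)) = cexp ((t : ℂ) / 2) := by congr 1; ring
    rw [e1, e2]
    ring
  · exact ((Complex.continuous_ofReal.comp b.continuous).mul (by fun_prop)).integrable_of_hasCompactSupport
      ((b.hasCompactSupport.comp_left Complex.ofReal_zero).mul_right)
  · exact ((Complex.continuous_ofReal.comp b.continuous).mul (by fun_prop)).integrable_of_hasCompactSupport
      ((b.hasCompactSupport.comp_left Complex.ofReal_zero).mul_right)

variable (hc : 1 / 2 ≤ m - b.rOut)
include hc

theorem bumpC_eq_zero_of_nonpos {t : ℝ} (ht : t ≤ 0) : bumpC b t = 0 :=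
  bumpC_eq_zero b fun h => by have := h.1; linarith

theorem bump_eq_zero_of_nonpos {t : ℝ} (ht : t ≤ 0) : b t = 0 :=
  bump_eq_zero b fun h => by have := h.1; linarith

/-- No prime enters: `log n ∉ supp` by hypothesis and `-log n ≤ 0 < 1/2 ≤ inf supp`. -/
theorem weilPrimeTerm_bumpC
    (hlog : ∀ n : ℕ, 2 ≤ n → Real.log n ∉ Set.Icc (m - b.rOut) (m + b.rOut)) :
    weilPrimeTerm (bumpC b) = 0 := by
  unfold weilPrimeTerm
  refine (tsum_congr fun n => ?_).trans tsum_zero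
  rcases Nat.lt_or_ge n 2 with hn | hn
  · interval_cases n <;> simp
  · have h1 : bumpC b (Real.log n) = 0 := bumpC_eq_zero b (hlog n hn)
    have hn' : (1 : ℝ) ≤ n := by exact_mod_cast (by omega : 1 ≤ n)
    have h2 : bumpC b (-Real.log n) = 0 :=
      bumpC_eq_zero_of_nonpos b hc (by linarith [Real.log_nonneg hn'])
    rw [h1, h2]
    simp

/-- The archimedean term (Bombieri's form, `g(0) = 0`, `g(-t) = 0` for `t > 0`):
`W_∞(g) = -∫₀^∞ e^{t/2} b(t)/(2 sinh t) dt`. -/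
theorem weilArchTerm_bumpC :
    weilArchTerm (bumpC b) =
      -(((∫ t in Set.Ioi (0 : ℝ), Real.exp (t / 2) * b t / (2 * Real.sinh t) : ℝ) : ℂ)) := by
  rw [← weilArchTermBombieri_eq_weilArchTerm_holds (isWeilTest_bumpC b), weilArchTermBombieri,
    bumpC_eq_zero_of_nonpos b hc le_rfl, ← integral_complex_ofReal]
  simp only [mul_zero, zero_add, sub_zero]
  congr 1
  refine setIntegral_congr_fun measurableSet_Ioi fun t ht => ?_
  have ht' : -t ≤ 0 := by have : (0 : ℝ) < t := ht; linarith
  rw [bumpC_eq_zero_of_nonpos b hc ht']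
  simp only [bumpC, add_zero]
  push_cast
  ring

/-- **`Re W(g) > 0`** for the complexified non-negative bump `g = b` supported in
`[m - r, m + r] ⊆ [1/2, ∞)` containing no `log n` (`n ≥ 2`): `W(g) = ∫ b·(e^{-t/2} + e^{t/2}) −
∫₀^∞ e^{t/2} b/(2 sinh t) ≥ ∫ b e^{-t/2} > 0` since `2 sinh t ≥ 1` on the support. -/
theorem weilFunctional_bumpC_re_pos
    (hlog : ∀ n : ℕ, 2 ≤ n → Real.log n ∉ Set.Icc (m - b.rOut) (m + b.rOut)) :
    0 < (weilFunctional (bumpC b)).re := by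
  rw [weilFunctional, weilPrimeTerm_bumpC b hc hlog, sub_zero, weilPolarTerm_bumpC b,
    weilArchTerm_bumpC b hc]
  simp only [Complex.add_re, Complex.neg_re, Complex.ofReal_re]
  -- integrability facts
  have hbi : Integrable (fun t : ℝ => b t) := b.continuous.integrable_of_hasCompactSupport b.hasCompactSupport
  have hi1 : Integrable fun t : ℝ => b t * (Real.exp (-t / 2) + Real.exp (t / 2)) :=
    (b.continuous.mul (by fun_prop)).integrable_of_hasCompactSupport b.hasCompactSupport.mul_right
  have hi2 : Integrable fun t : ℝ => Real.exp (t / 2) * b t :=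
    ((by fun_prop : Continuous fun t : ℝ => Real.exp (t / 2)).mul b.continuous).integrable_of_hasCompactSupport
      b.hasCompactSupport.mul_left
  -- the archimedean integral is at most `∫ e^{t/2} b` (since `2 sinh t ≥ 1` where `b ≠ 0`)
  have hA : ∫ t in Set.Ioi (0 : ℝ), Real.exp (t / 2) * b t / (2 * Real.sinh t) ≤
      ∫ t in Set.Ioi (0 : ℝ), Real.exp (t / 2) * b t := by
    refine integral_mono_of_nonneg ?_ hi2.integrableOn ?_
    · filter_upwards [ae_restrict_mem measurableSet_Ioi] with t ht
      exact div_nonneg (mul_nonneg (Real.exp_pos _).le b.nonneg)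
        (mul_nonneg zero_le_two (Real.sinh_nonneg_iff.2 (le_of_lt ht)))
    · filter_upwards [ae_restrict_mem measurableSet_Ioi] with t ht
      by_cases hts : t ∈ Set.Icc (m - b.rOut) (m + b.rOut)
      · have ht2 : 1 ≤ 2 * Real.sinh t := by
          have h1 : (1 / 2 : ℝ) ≤ t := by have := hts.1; linarith
          have h2 : t ≤ Real.sinh t := Real.self_le_sinh_iff.2 (by linarith)
          linarith
        rw [div_le_iff₀ (by linarith)]
        nlinarith [mul_nonneg (Real.exp_pos (t / 2)).le (b.nonneg (x := t))]
      · rw [bump_eq_zero b hts]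
        simp
  -- `∫₀^∞ e^{t/2} b = ∫ e^{t/2} b` (the integrand vanishes for `t ≤ 0`)
  have hA' : ∫ t in Set.Ioi (0 : ℝ), Real.exp (t / 2) * b t = ∫ t, Real.exp (t / 2) * b t := by
    refine setIntegral_eq_integral_of_forall_compl_eq_zero fun t ht => ?_
    rw [bump_eq_zero_of_nonpos b hc (by simpa using ht), mul_zero]
  -- lower bound `∫ b e^{-t/2} ≥ e^{-(m + r)/2} ∫ b > 0`
  have hlow : Real.exp (-(m + b.rOut) / 2) * ∫ t, b t ≤ ∫ t, b t * Real.exp (-t / 2) := by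
    rw [← integral_const_mul]
    refine integral_mono (hbi.const_mul _) ?_ fun t => ?_
    · exact (b.continuous.mul (by fun_prop)).integrable_of_hasCompactSupport b.hasCompactSupport.mul_right
    · show Real.exp (-(m + b.rOut) / 2) * b t ≤ b t * Real.exp (-t / 2)
      by_cases hts : t ∈ Set.Icc (m - b.rOut) (m + b.rOut)
      · have : Real.exp (-(m + b.rOut) / 2) ≤ Real.exp (-t / 2) :=
          Real.exp_le_exp.2 (by have := hts.2; linarith)
        nlinarith [b.nonneg (x := t)]
      · rw [bump_eq_zero b hts]
        simp
  have hsplit : ∫ t, b t * (Real.exp (-t / 2) + Real.exp (t / 2)) =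
      (∫ t, b t * Real.exp (-t / 2)) + ∫ t, Real.exp (t / 2) * b t := by
    rw [← integral_add]
    · congr 1 with t
      ring
    · exact (b.continuous.mul (by fun_prop)).integrable_of_hasCompactSupport b.hasCompactSupport.mul_right
    · exact hi2
  have hpos : 0 < Real.exp (-(m + b.rOut) / 2) * ∫ t, b t := mul_pos (Real.exp_pos _) b.integral_pos
  rw [hsplit]
  linarith

end BumpPositivity


/-! ### No finite union of arithmetic progressions realises a window -/

/-- Re-indexing a family along an equivalence preserves the window identity. -/
theorem Trace.comp_equiv {A : ℝ} {ι κ : Type} {γ : ι → ℝ} (h : Trace A ι γ) (e : κ ≃ ι) :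
    Trace A κ (γ ∘ e) := fun g hg hsupp =>
  (e.hasSum_iff (f := fun i => weilMellin g (1 / 2 + (γ i : ℂ) * Complex.I))).2 (h g hg hsupp)

/-- The lattice points `2πk/α` (`k : ℤ`) lying in a bounded interval form a finite set. -/
theorem finite_lattice_inter {α : ℝ} (hα : α ≠ 0) (u v : ℝ) :
    {x : ℝ | x ∈ Set.Ioo u v ∧ ∃ k : ℤ, x = 2 * π * k / α}.Finite := by
  set R : ℝ := max |u| |v| * |α| / (2 * π) with hR
  have hαpos : 0 < |α| := abs_pos.2 hα
  have h2π : (0 : ℝ) < 2 * π := by positivity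
  refine ((Set.finite_Icc (-⌈R⌉) ⌈R⌉).image fun k : ℤ => 2 * π * (k : ℝ) / α).subset ?_
  rintro x ⟨hx, k, rfl⟩
  refine ⟨k, ?_, rfl⟩
  have hxabs : |2 * π * (k : ℝ) / α| ≤ max |u| |v| := by
    refine abs_le.2 ⟨?_, ?_⟩
    · linarith [hx.1, neg_abs_le u, le_max_left |u| |v|]
    · linarith [hx.2, le_abs_self v, le_max_right |u| |v|]
  have hk : |(k : ℝ)| ≤ R := by
    rw [abs_div, abs_mul, abs_of_pos h2π, div_le_iff₀ hαpos] at hxabs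
    rw [hR, le_div_iff₀ h2π]
    linarith
  have hk' := abs_le.1 hk
  simp only [Set.mem_Icc]
  constructor
  · have : (-(⌈R⌉ : ℤ) : ℝ) ≤ k := by linarith [Int.le_ceil R]
    exact_mod_cast this
  · have : (k : ℝ) ≤ (⌈R⌉ : ℤ) := hk'.2.trans (Int.le_ceil R)
    exact_mod_cast this

/-- **No finite union of arithmetic progressions realises a window.** If `[u, v] ⊆ [1/2, A]`
(`u < v`) contains no `log n` (`n ≥ 2`), then no family `γ(j, n) = α_j n + β_j` on `Fin J × ℤ`
(`α_j ≠ 0`) satisfies `Trace A`. Proof: pick a non-negative bump `g` inside `(u, v)` avoiding the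
finitely many dual-lattice points `2πk/α_j`; by Poisson summation every progression contributes
`(2π/α_j) Σ_k e^{2πikβ_j/α_j} g(2πk/α_j) = 0` (`tsum_lineSample_eq_zero'`), so the family's sum is
`0`, while `Re W(g) > 0` (`weilFunctional_bumpC_re_pos`). -/
theorem not_trace_progressions {A u v : ℝ} (hu : 1 / 2 ≤ u) (huv : u < v) (hvA : v ≤ A)
    (hlog : ∀ n : ℕ, 2 ≤ n → Real.log n ∉ Set.Icc u v)
    {J : ℕ} (α β : Fin J → ℝ) (hα : ∀ j, α j ≠ 0) :
    ¬ Trace A (Fin J × ℤ) (fun p => α p.1 * p.2 + β p.1) := by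
  intro hT
  -- bad points: the dual-lattice points of the `J` progressions inside `(u, v)`
  set P : Set ℝ := ⋃ j : Fin J, {x : ℝ | x ∈ Set.Ioo u v ∧ ∃ k : ℤ, x = 2 * π * k / α j} with hP
  have hPfin : P.Finite := Set.finite_iUnion fun j => finite_lattice_inter (hα j) u v
  -- a point of `(u, v)` off `P`, with a ball around it
  have hU : IsOpen (Set.Ioo u v \ P) := isOpen_Ioo.sdiff hPfin.isClosed
  obtain ⟨x, hx⟩ : (Set.Ioo u v \ P).Nonempty := ((Set.Ioo_infinite huv).sdiff hPfin).nonempty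
  obtain ⟨ε, hε, hball⟩ := Metric.isOpen_iff.1 hU x hx
  -- the bump centred at `x`, radius `ε/2`
  let b : ContDiffBump x := ⟨ε / 4, ε / 2, by positivity, by linarith⟩
  have hrOut : b.rOut = ε / 2 := rfl
  have hIcc : Set.Icc (x - b.rOut) (x + b.rOut) ⊆ Set.Ioo u v \ P := by
    intro y hy
    apply hball
    rw [Metric.mem_ball, Real.dist_eq, abs_lt]
    rw [hrOut] at hy
    constructor <;> linarith [hy.1, hy.2]
  have hc : 1 / 2 ≤ x - b.rOut := by
    have h1 := (hIcc ⟨le_rfl, by linarith [b.rOut_pos]⟩).1.1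
    linarith
  have hlog' : ∀ n : ℕ, 2 ≤ n → Real.log n ∉ Set.Icc (x - b.rOut) (x + b.rOut) :=
    fun n hn h => hlog n hn (Set.Ioo_subset_Icc_self (hIcc h).1)
  have hg : IsWeilTest (bumpC b) := isWeilTest_bumpC b
  have hsupp : tsupport (bumpC b) ⊆ Set.Icc (-A) A := by
    refine (tsupport_bumpC b).trans fun y hy => ?_
    have hy' := (hIcc hy).1
    constructor <;> linarith [hy'.1, hy'.2]
  have hsum := hT (bumpC b) hg hsupp
  -- `g` vanishes on every dual lattice
  have hzero : ∀ j : Fin J, ∀ k : ℤ, bumpC b (2 * π * k / α j) = 0 := by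
    intro j k
    apply bumpC_eq_zero b
    intro hmem
    have h1 := hIcc hmem
    exact h1.2 (Set.mem_iUnion.2 ⟨j, h1.1, k, rfl⟩)
  -- each progression contributes `0`
  have hfib : ∀ j : Fin J, HasSum (fun n : ℤ => lineSample (bumpC b) (α j) (β j) n) 0 := by
    intro j
    have hs0 := hsum.summable.comp_injective (Prod.mk_right_injective j)
    have hs : Summable fun n : ℤ => lineSample (bumpC b) (α j) (β j) n := by
      refine hs0.congr fun n => ?_
      simp only [Function.comp_apply, lineSample]
    have h0 : ∑' n : ℤ, lineSample (bumpC b) (α j) (β j) n = 0 :=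
      tsum_lineSample_eq_zero' hg (hα j) (β j) (hzero j)
    rw [← h0]
    exact hs.hasSum
  have hsum' : HasSum (fun p : Fin J × ℤ => lineSample (bumpC b) (α p.1) (β p.1) p.2)
      (weilFunctional (bumpC b)) := by
    refine hsum.congr_fun fun p => ?_
    simp only [lineSample]
  have hW : HasSum (fun _ : Fin J => (0 : ℂ)) (weilFunctional (bumpC b)) :=
    HasSum.prod_fiberwise (f := fun p : Fin J × ℤ => lineSample (bumpC b) (α p.1) (β p.1) p.2)
      (g := fun _ : Fin J => (0 : ℂ)) hsum' hfib
  have hW0 : weilFunctional (bumpC b) = 0 := hW.unique hasSum_zero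
  have hpos := weilFunctional_bumpC_re_pos b hc hlog'
  rw [hW0, Complex.zero_re] at hpos
  exact lt_irrefl 0 hpos

/-- The interval `[0.7, 1]` contains no `log n`, `n ≥ 2` (`log 2 < 0.694`, `log 3 > 1`). -/
theorem log_notMem_Icc (n : ℕ) (hn : 2 ≤ n) : Real.log n ∉ Set.Icc (0.7 : ℝ) 1 := by
  intro h
  rcases Nat.lt_or_ge n 3 with h3 | h3
  · interval_cases n
    have := Real.log_two_lt_d9
    norm_num at this h
    linarith [h.1]
  · have h3' : (3 : ℝ) ≤ n := by exact_mod_cast h3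
    have hlog3 : 1 < Real.log 3 := (Real.lt_log_iff_exp_lt (by norm_num)).mpr Real.exp_one_lt_three
    have := Real.log_le_log (by norm_num) h3'
    linarith [h.2]

/-- **The crux has no witness made of finitely many arithmetic progressions**
(`γ(j, n) = α_j n + β_j`, any slopes `α_j ≠ 0`, any shifts, any `J`). -/
theorem not_windowTracePrime2_progressions {J : ℕ} (α β : Fin J → ℝ) (hα : ∀ j, α j ≠ 0) :
    ¬ Trace (Real.log 3) (Fin J × ℤ) (fun p => α p.1 * p.2 + β p.1) :=
  not_trace_progressions (u := 0.7) (v := 1) (by norm_num) (by norm_num)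
    ((Real.lt_log_iff_exp_lt (by norm_num)).mpr Real.exp_one_lt_three).le
    log_notMem_Icc α β hα

/-- `Fin 1 × ℤ ≃ ℤ`, by the second projection (definitionally). -/
def finOneProdEquiv : Fin 1 × ℤ ≃ ℤ where
  toFun p := p.2
  invFun n := (0, n)
  left_inv p := by
    rcases p with ⟨j, n⟩
    simp only [Prod.mk.injEq, and_true]
    exact (Fin.eq_zero j).symm
  right_inv _ := rfl

/-- In particular NO SINGLE ARITHMETIC PROGRESSION `γ_n = αn + β` (`α ≠ 0`) is a witness of the
crux (the case the route's text starts from: a lattice reproduces only `c·δ`'s on the window). -/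
theorem not_windowTracePrime2_progression (α β : ℝ) (hα : α ≠ 0) :
    ¬ Trace (Real.log 3) ℤ (fun n => α * n + β) := fun h =>
  not_windowTracePrime2_progressions (fun _ => α) (fun _ => β) (fun _ => hα)
    (h.comp_equiv finOneProdEquiv)

/-- The same for the archimedean rung `WindowTraceArch` (`A = log 2`), via the prime-free interval
`[1/2, 0.69]`. -/
theorem log_notMem_Icc' (n : ℕ) (hn : 2 ≤ n) : Real.log n ∉ Set.Icc (1 / 2 : ℝ) 0.69 := by
  intro h
  have h2 : (2 : ℝ) ≤ n := by exact_mod_cast hn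
  have := Real.log_le_log (by norm_num) h2
  have h2' := Real.log_two_gt_d9
  norm_num at h2' h
  linarith [h.2]

theorem not_windowTraceArch_progressions {J : ℕ} (α β : Fin J → ℝ) (hα : ∀ j, α j ≠ 0) :
    ¬ Trace (Real.log 2) (Fin J × ℤ) (fun p => α p.1 * p.2 + β p.1) := by
  refine not_trace_progressions (u := 1 / 2) (v := 0.69) le_rfl (by norm_num) ?_ log_notMem_Icc' α β hα
  have := Real.log_two_gt_d9
  norm_num at this ⊢
  linarith

/-! ## Local counting law for witnesses: `O(log T)` from above, unbounded from below -/

/-! ### Modulated tests `k_T(t) = k(t) e^{-iTt}` and the shifted identity -/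

/-- Modulation by a unimodular character: `k_T(t) = k(t) e^{-iTt}`. -/
def modulate (k : ℝ → ℂ) (T : ℝ) : ℝ → ℂ := fun t => k t * cexp (((-(T * t) : ℝ) : ℂ) * I)

theorem norm_modulate (k : ℝ → ℂ) (T t : ℝ) : ‖modulate k T t‖ = ‖k t‖ := by
  rw [modulate, norm_mul, Complex.norm_exp_ofReal_mul_I, mul_one]

theorem modulate_zero (k : ℝ → ℂ) (T : ℝ) : modulate k T 0 = k 0 := by
  simp [modulate]

theorem contDiff_modChar (T : ℝ) : ContDiff ℝ ∞ fun t : ℝ => cexp (((-(T * t) : ℝ) : ℂ) * I) := by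
  have h1 : ContDiff ℝ ∞ fun t : ℝ => ((-(T * t) : ℝ) : ℂ) :=
    Complex.ofRealCLM.contDiff.comp ((contDiff_const.mul contDiff_id).neg)
  exact (h1.mul contDiff_const).cexp

theorem isWeilTest_modulate {k : ℝ → ℂ} (hk : IsWeilTest k) (T : ℝ) : IsWeilTest (modulate k T) :=
  ⟨hk.1.mul (contDiff_modChar T), hk.2.mul_right⟩

theorem tsupport_modulate_subset (k : ℝ → ℂ) (T : ℝ) : tsupport (modulate k T) ⊆ tsupport k :=
  tsupport_mul_subset_left

/-- `k̂_T(s) = k̂(s - iT)`: modulation shifts the transform along vertical lines. -/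
theorem weilMellin_modulate (k : ℝ → ℂ) (T : ℝ) (s : ℂ) :
    weilMellin (modulate k T) s = weilMellin k (s - T * I) := by
  unfold weilMellin modulate
  congr 1 with t
  rw [mul_assoc, ← Complex.exp_add]
  congr 2
  push_cast
  ring

/-- **The shifted identity.** For a witness `γ` of `Trace A` and a test `φ` supported in
`[-a, a]`, `2a ≤ A`: `Σ_i |φ̂(1/2 + i(γ_i - T))|² = Re W(k_T)` with `k = φ ⋆ φ̃`, for every real `T`
(test the identity on the modulated `k_T`, supported in `[-A, A]`; `k̂_T(1/2+iγ) = k̂(1/2+i(γ-T))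
= |φ̂(1/2+i(γ-T))|²`). This is the counting device behind every density statement. -/
theorem hasSum_norm_sq_shift {A : ℝ} {ι : Type} {γ : ι → ℝ} (h : Trace A ι γ) {φ : ℝ → ℂ}
    (hφ : IsWeilTest φ) {a : ℝ} (hφs : tsupport φ ⊆ Set.Icc (-a) a) (h2a : 2 * a ≤ A) (T : ℝ) :
    HasSum (fun i => ‖weilMellin φ (1 / 2 + ((γ i - T : ℝ) : ℂ) * I)‖ ^ 2)
      (weilFunctional (modulate (weilConv φ (weilReflect φ)) T)).re := by
  have hk : IsWeilTest (weilConv φ (weilReflect φ)) := hφ.weilConv hφ.weilReflect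
  have hks : tsupport (weilConv φ (weilReflect φ)) ⊆ Set.Icc (-A) A :=
    (tsupport_weilConv_weilReflect_subset hφ.2 hφs).trans
      (Set.Icc_subset_Icc (by linarith) (by linarith))
  have hs := h _ (isWeilTest_modulate hk T) ((tsupport_modulate_subset _ T).trans hks)
  have key : ∀ i, (weilMellin (modulate (weilConv φ (weilReflect φ)) T)
      (1 / 2 + (γ i : ℂ) * Complex.I)).re = ‖weilMellin φ (1 / 2 + ((γ i - T : ℝ) : ℂ) * I)‖ ^ 2 := by
    intro i
    rw [weilMellin_modulate, show (1 / 2 : ℂ) + (γ i : ℂ) * Complex.I - T * I =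
        1 / 2 + ((γ i - T : ℝ) : ℂ) * I by push_cast; ring,
      weilMellin_weilQuadratic_of_re_eq hφ (by simp), Complex.ofReal_re, Complex.normSq_eq_norm_sq]
  exact (Complex.hasSum_re hs).congr_fun fun i => (key i).symm

/-! ### `T`-independent bounds for the polar and prime terms of `W(k_T)` -/

/-- `|k̂_T(0) + k̂_T(1)| ≤ 2 ∫ |k| e^{|t|/2}`. -/
theorem norm_weilPolarTerm_modulate_le {k : ℝ → ℂ} (hk : IsWeilTest k) (T : ℝ) :
    ‖weilPolarTerm (modulate k T)‖ ≤ 2 * weilL1W (1 / 2) k := by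
  unfold weilPolarTerm
  rw [weilMellin_modulate, weilMellin_modulate]
  have h0 : ‖weilMellin k (0 - T * I)‖ ≤ weilL1W (1 / 2) k :=
    norm_weilMellin_le_weilL1W hk.1.continuous hk.2 (by norm_num [abs_of_nonneg])
  have h1 : ‖weilMellin k (1 - T * I)‖ ≤ weilL1W (1 / 2) k :=
    norm_weilMellin_le_weilL1W hk.1.continuous hk.2 (by norm_num [abs_of_nonneg])
  calc ‖weilMellin k (0 - T * I) + weilMellin k (1 - T * I)‖
      ≤ ‖weilMellin k (0 - T * I)‖ + ‖weilMellin k (1 - T * I)‖ := norm_add_le _ _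
    _ ≤ 2 * weilL1W (1 / 2) k := by linarith

/-- The `T`-independent majorant `Σₙ Λ(n) n^{-1/2} (|k(log n)| + |k(-log n)|)` of the prime term. -/
def primeMajorant (k : ℝ → ℂ) : ℝ :=
  ∑' n : ℕ, ‖((Λ n : ℝ) : ℂ) / (Real.sqrt n : ℂ)‖ * (‖k (Real.log n)‖ + ‖k (-Real.log n)‖)

theorem summable_primeMajorant {k : ℝ → ℂ} (hk : HasCompactSupport k) :
    Summable fun n : ℕ => ‖((Λ n : ℝ) : ℂ) / (Real.sqrt n : ℂ)‖ * (‖k (Real.log n)‖ + ‖k (-Real.log n)‖) := by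
  obtain ⟨R, hR⟩ := hk.isCompact.isBounded.subset_closedBall 0
  refine summable_of_ne_finset_zero (s := Finset.range ⌈Real.exp (|R| + 1)⌉₊) fun n hn => ?_
  rw [Finset.mem_range, not_lt] at hn
  have hn' : Real.exp (|R| + 1) ≤ n := (Nat.le_ceil _).trans (by exact_mod_cast hn)
  have hpos : (0 : ℝ) < n := (Real.exp_pos _).trans_le hn'
  have hlog : |R| + 1 ≤ Real.log n := by rwa [Real.le_log_iff_exp_le hpos]
  have h0 : ∀ x : ℝ, |R| < |x| → k x = 0 := fun x hx =>
    image_eq_zero_of_notMem_tsupport fun hxs => by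
      have hxR := hR hxs
      rw [Metric.mem_closedBall, dist_zero_right, Real.norm_eq_abs] at hxR
      linarith [le_abs_self R]
  have h1 : |R| < |Real.log n| := lt_of_lt_of_le (by linarith) (le_abs_self _)
  rw [h0 _ h1, h0 _ (by rwa [abs_neg]), norm_zero, add_zero, mul_zero]

theorem primeMajorant_nonneg (k : ℝ → ℂ) : 0 ≤ primeMajorant k :=
  tsum_nonneg fun _ => by positivity

/-- `|prime term of k_T| ≤ primeMajorant k` (the character has modulus one). -/
theorem norm_weilPrimeTerm_modulate_le {k : ℝ → ℂ} (hk : HasCompactSupport k) (T : ℝ) :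
    ‖weilPrimeTerm (modulate k T)‖ ≤ primeMajorant k := by
  have hterm : ∀ n : ℕ, ‖((Λ n : ℝ) : ℂ) / (Real.sqrt n : ℂ) *
      (modulate k T (Real.log n) + modulate k T (-Real.log n))‖ ≤
      ‖((Λ n : ℝ) : ℂ) / (Real.sqrt n : ℂ)‖ * (‖k (Real.log n)‖ + ‖k (-Real.log n)‖) := by
    intro n
    rw [norm_mul]
    refine mul_le_mul_of_nonneg_left ?_ (norm_nonneg _)
    calc ‖modulate k T (Real.log n) + modulate k T (-Real.log n)‖
        ≤ ‖modulate k T (Real.log n)‖ + ‖modulate k T (-Real.log n)‖ := norm_add_le _ _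
      _ = ‖k (Real.log n)‖ + ‖k (-Real.log n)‖ := by rw [norm_modulate, norm_modulate]
  have hs : Summable fun n : ℕ => ‖((Λ n : ℝ) : ℂ) / (Real.sqrt n : ℂ) *
      (modulate k T (Real.log n) + modulate k T (-Real.log n))‖ :=
    Summable.of_nonneg_of_le (fun _ => norm_nonneg _) hterm (summable_primeMajorant hk)
  unfold weilPrimeTerm primeMajorant
  exact (norm_tsum_le_tsum_norm hs).trans (hs.tsum_le_tsum hterm (summable_primeMajorant hk))

/-! ### The archimedean term of `W(k_T)`: exact real formula, integrability, upper bound -/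

/-- On the critical line the transform of `k_T`, `k = φ ⋆ φ̃`, is the shifted squared modulus. -/
theorem weilMellin_modulate_conv_half {φ : ℝ → ℂ} (hφ : IsWeilTest φ) (T τ : ℝ) :
    weilMellin (modulate (weilConv φ (weilReflect φ)) T) (1 / 2 + τ * I) =
      ((‖weilMellin φ (1 / 2 + ((τ - T : ℝ) : ℂ) * I)‖ ^ 2 : ℝ) : ℂ) := by
  rw [weilMellin_modulate, show (1 / 2 : ℂ) + τ * I - T * I = 1 / 2 + ((τ - T : ℝ) : ℂ) * I by
    push_cast; ring, weilMellin_weilQuadratic_of_re_eq hφ (by simp), Complex.normSq_eq_norm_sq]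

/-- The archimedean integral of `k_T` as a real integral. -/
theorem weilArchIntegral_modulate_conv {φ : ℝ → ℂ} (hφ : IsWeilTest φ) (T : ℝ) :
    weilArchIntegral (modulate (weilConv φ (weilReflect φ)) T) =
      ((∫ τ : ℝ, ‖weilMellin φ (1 / 2 + ((τ - T : ℝ) : ℂ) * I)‖ ^ 2 *
        (Complex.digamma (1 / 4 + τ / 2 * I)).re : ℝ) : ℂ) := by
  unfold weilArchIntegral
  rw [← integral_complex_ofReal]
  congr 1 with τ
  rw [weilMellin_modulate_conv_half hφ]
  push_cast
  ring

/-- Crude growth of the digamma weight: `|Re ψ(1/4 + iτ/2)| ≤ log(3 + |τ|) + 12`. -/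
theorem abs_re_digamma_quarter_le (τ : ℝ) :
    |(Complex.digamma (1 / 4 + τ / 2 * I)).re| ≤ Real.log (3 + |τ|) + 12 := by
  have h := KadiriGamma.abs_re_digamma_le τ
  have e : ((((1 / 2 : ℝ)) : ℂ) + τ * I) / 2 = 1 / 4 + τ / 2 * I := by push_cast; ring
  rwa [e] at h

/-- The digamma weight is continuous in `τ`. -/
theorem continuous_re_digamma_quarter :
    Continuous fun τ : ℝ => (Complex.digamma (1 / 4 + τ / 2 * I)).re := by
  have h := continuous_re_digamma_vertical (σ := 1 / 4) (by norm_num)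
  have h' : Continuous fun τ : ℝ => (Complex.digamma (((1 / 4 : ℝ) : ℂ) + ((τ / 2 : ℝ) : ℂ) * I)).re :=
    h.comp (continuous_id.div_const 2)
  refine h'.congr fun τ => ?_
  congr 2
  push_cast
  ring

theorem log_three_add_abs_le (T τ : ℝ) :
    Real.log (3 + |τ|) ≤ Real.log (3 + |T|) + Real.log (1 + |τ - T|) := by
  rw [← Real.log_mul (by positivity) (by positivity)]
  apply Real.log_le_log (by positivity)
  have h1 : |τ| ≤ |T| + |τ - T| := by
    have := abs_add_le T (τ - T)
    rwa [add_sub_cancel] at this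
  nlinarith [abs_nonneg T, abs_nonneg (τ - T)]

/-- Integrability of `u ↦ |φ̂(1/2+iu)|² · L(u)` against any continuous weight of linear growth
(decay `|φ̂| ≤ D/(1+u²)²`, `integrable_mul_weilMellin_vertical_of_norm_le_linear`). -/
theorem integrable_norm_sq_weilMellin_mul {φ : ℝ → ℂ} (hφ : IsWeilTest φ) {L : ℝ → ℝ}
    (hL : Continuous L) {C : ℝ} (hC : ∀ u, |L u| ≤ C * (1 + |u|)) :
    Integrable fun u : ℝ => ‖weilMellin φ (1 / 2 + (u : ℂ) * I)‖ ^ 2 * L u := by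
  set B : ℝ := weilL1W 0 φ with hB
  have hB0 : 0 ≤ B := weilL1W_nonneg 0 φ
  have hbd : ∀ u : ℝ, ‖weilMellin φ (1 / 2 + (u : ℂ) * I)‖ ≤ B := fun u =>
    norm_weilMellin_le_weilL1W hφ.1.continuous hφ.2 (by simp)
  set F : ℝ → ℂ := fun u => (starRingEnd ℂ) (weilMellin φ (1 / 2 + (u : ℂ) * I)) * (L u : ℂ)
    with hF
  have hFc : Continuous F := by
    have h1 : Continuous fun u : ℝ => weilMellin φ (1 / 2 + (u : ℂ) * I) :=
      (continuous_weilMellin hφ.1.continuous hφ.2).comp (by fun_prop)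
    exact (Complex.continuous_conj.comp h1).mul (Complex.continuous_ofReal.comp hL)
  have hFb : ∀ u, ‖F u‖ ≤ (B * C) * (1 + |u|) := fun u => by
    rw [hF, norm_mul, Complex.norm_conj, Complex.norm_real, Real.norm_eq_abs]
    calc ‖weilMellin φ (1 / 2 + (u : ℂ) * I)‖ * |L u| ≤ B * (C * (1 + |u|)) :=
          mul_le_mul (hbd u) (hC u) (abs_nonneg _) hB0
      _ = B * C * (1 + |u|) := by ring
  have hint := integrable_mul_weilMellin_vertical_of_norm_le_linear hφ (1 / 2) hFc hFb
  have hint' : Integrable fun u : ℝ => ((‖weilMellin φ (1 / 2 + (u : ℂ) * I)‖ ^ 2 * L u : ℝ) : ℂ) := by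
    refine hint.congr (Eventually.of_forall fun u => ?_)
    simp only [hF]
    push_cast
    rw [mul_right_comm, Complex.conj_mul']
  refine hint'.re.congr (Eventually.of_forall fun u => ?_)
  simp only [RCLike.re_to_complex, Complex.ofReal_re]

/-- `∫ |φ̂(1/2+iu)|² du` (`= 2π ‖φ‖₂²` by Plancherel, not needed). -/
def sqMass (φ : ℝ → ℂ) : ℝ := ∫ u : ℝ, ‖weilMellin φ (1 / 2 + (u : ℂ) * I)‖ ^ 2

/-- `∫ |φ̂(1/2+iu)|² log(1+|u|) du`. -/
def sqLogMass (φ : ℝ → ℂ) : ℝ := ∫ u : ℝ, ‖weilMellin φ (1 / 2 + (u : ℂ) * I)‖ ^ 2 * Real.log (1 + |u|)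

theorem sqMass_nonneg (φ : ℝ → ℂ) : 0 ≤ sqMass φ := integral_nonneg fun _ => by positivity

theorem sqLogMass_nonneg (φ : ℝ → ℂ) : 0 ≤ sqLogMass φ :=
  integral_nonneg fun u => mul_nonneg (by positivity) (Real.log_nonneg (by linarith [abs_nonneg u]))

theorem continuous_log_one_add_abs : Continuous fun u : ℝ => Real.log (1 + |u|) :=
  Continuous.log (by fun_prop) fun u => by positivity

theorem log_one_add_abs_le (u : ℝ) : |Real.log (1 + |u|)| ≤ 1 * (1 + |u|) := by
  have h0 : 0 ≤ Real.log (1 + |u|) := Real.log_nonneg (by linarith [abs_nonneg u])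
  rw [abs_of_nonneg h0, one_mul]
  have := Real.log_le_sub_one_of_pos (by positivity : (0 : ℝ) < 1 + |u|)
  linarith [abs_nonneg u]

/-- **Upper bound for the archimedean integral of `k_T`**:
`∫ |φ̂(τ−T)|² Re ψ(1/4+iτ/2) dτ ≤ (log(3+|T|) + 12)·∫|φ̂|² + ∫|φ̂|² log(1+|u|)`. -/
theorem archIntegral_modulate_le {φ : ℝ → ℂ} (hφ : IsWeilTest φ) (T : ℝ) :
    ∫ τ : ℝ, ‖weilMellin φ (1 / 2 + ((τ - T : ℝ) : ℂ) * I)‖ ^ 2 *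
        (Complex.digamma (1 / 4 + τ / 2 * I)).re ≤
      (Real.log (3 + |T|) + 12) * sqMass φ + sqLogMass φ := by
  set F : ℝ → ℝ := fun u => ‖weilMellin φ (1 / 2 + (u : ℂ) * I)‖ ^ 2 with hF
  have hFnn : ∀ u, 0 ≤ F u := fun u => by positivity
  -- integrability of the integrand (weight of logarithmic growth) via the modulated test
  have hmod : ∀ τ : ℝ, ‖weilMellin φ (1 / 2 + ((τ - T : ℝ) : ℂ) * I)‖ ^ 2 =
      ‖weilMellin (modulate φ T) (1 / 2 + (τ : ℂ) * I)‖ ^ 2 := fun τ => by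
    rw [weilMellin_modulate]
    congr 3
    push_cast
    ring
  have hI1 : Integrable fun τ : ℝ => ‖weilMellin φ (1 / 2 + ((τ - T : ℝ) : ℂ) * I)‖ ^ 2 *
      (Complex.digamma (1 / 4 + τ / 2 * I)).re := by
    have h := integrable_norm_sq_weilMellin_mul (isWeilTest_modulate hφ T)
      continuous_re_digamma_quarter (C := 14) fun τ => by
        have h1 := abs_re_digamma_quarter_le τ
        have h2 : Real.log (3 + |τ|) ≤ 2 + |τ| := by
          have := Real.log_le_sub_one_of_pos (by positivity : (0 : ℝ) < 3 + |τ|)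
          linarith
        nlinarith [abs_nonneg τ, abs_nonneg ((Complex.digamma (1 / 4 + τ / 2 * I)).re)]
    exact h.congr (Eventually.of_forall fun τ => by simp only [hmod])
  -- the majorant `F(τ - T)(c_T + log(1 + |τ - T|))`
  set cT : ℝ := Real.log (3 + |T|) + 12 with hcT
  have hG : Integrable fun u : ℝ => F u * (cT + Real.log (1 + |u|)) := by
    have h := integrable_norm_sq_weilMellin_mul hφ (L := fun u => cT + Real.log (1 + |u|))
      (continuous_const.add continuous_log_one_add_abs) (C := |cT| + 1) fun u => by
        have h1 := log_one_add_abs_le u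
        have h0 : 0 ≤ Real.log (1 + |u|) := Real.log_nonneg (by linarith [abs_nonneg u])
        calc |cT + Real.log (1 + |u|)| ≤ |cT| + |Real.log (1 + |u|)| := abs_add_le _ _
          _ ≤ |cT| * (1 + |u|) + 1 * (1 + |u|) := by
              nlinarith [abs_nonneg cT, abs_nonneg u]
          _ = (|cT| + 1) * (1 + |u|) := by ring
    exact h
  have hI2 : Integrable fun τ : ℝ => F (τ - T) * (cT + Real.log (1 + |τ - T|)) :=
    hG.comp_sub_right T
  -- pointwise comparison
  have hle : ∀ τ : ℝ, ‖weilMellin φ (1 / 2 + ((τ - T : ℝ) : ℂ) * I)‖ ^ 2 *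
      (Complex.digamma (1 / 4 + τ / 2 * I)).re ≤ F (τ - T) * (cT + Real.log (1 + |τ - T|)) := by
    intro τ
    have hFeq : ‖weilMellin φ (1 / 2 + ((τ - T : ℝ) : ℂ) * I)‖ ^ 2 = F (τ - T) := by
      simp only [hF]
    rw [hFeq]
    refine mul_le_mul_of_nonneg_left ?_ (hFnn _)
    have h1 := (le_abs_self _).trans (abs_re_digamma_quarter_le τ)
    have h2 := log_three_add_abs_le T τ
    linarith
  calc ∫ τ : ℝ, ‖weilMellin φ (1 / 2 + ((τ - T : ℝ) : ℂ) * I)‖ ^ 2 *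
          (Complex.digamma (1 / 4 + τ / 2 * I)).re
      ≤ ∫ τ : ℝ, F (τ - T) * (cT + Real.log (1 + |τ - T|)) := integral_mono hI1 hI2 hle
    _ = ∫ u : ℝ, F u * (cT + Real.log (1 + |u|)) :=
        integral_sub_right_eq_self (fun u => F u * (cT + Real.log (1 + |u|))) T
    _ = cT * sqMass φ + sqLogMass φ := by
        have hF1 : Integrable fun u : ℝ => F u * cT := by
          have h := integrable_norm_sq_weilMellin_mul hφ (L := fun _ => cT) continuous_const
            (C := |cT|) fun u => by nlinarith [abs_nonneg cT, abs_nonneg u]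
          exact h
        have hF2 : Integrable fun u : ℝ => F u * Real.log (1 + |u|) :=
          integrable_norm_sq_weilMellin_mul hφ continuous_log_one_add_abs log_one_add_abs_le
        simp_rw [mul_add]
        rw [integral_add hF1 hF2, sqMass, sqLogMass, ← integral_const_mul]
        congr 1
        refine integral_congr_ae (Eventually.of_forall fun u => ?_)
        simp only [hF]
        ring

/-- **Upper bound for `Re W(k_T)`**, `k = φ ⋆ φ̃`: logarithmic in `T` with explicit constants. -/
theorem re_weilFunctional_modulate_le {φ : ℝ → ℂ} (hφ : IsWeilTest φ) (T : ℝ) :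
    (weilFunctional (modulate (weilConv φ (weilReflect φ)) T)).re ≤
      sqMass φ / (2 * π) * Real.log (3 + |T|) +
        (2 * weilL1W (1 / 2) (weilConv φ (weilReflect φ)) +
          primeMajorant (weilConv φ (weilReflect φ)) +
          (12 * sqMass φ + sqLogMass φ) / (2 * π) +
          ‖weilConv φ (weilReflect φ) 0‖ * Real.log π) := by
  set k := weilConv φ (weilReflect φ) with hk_def
  have hk : IsWeilTest k := hφ.weilConv hφ.weilReflect
  have hpol := norm_weilPolarTerm_modulate_le hk T
  have hpri := norm_weilPrimeTerm_modulate_le hk.2 T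
  have harch := archIntegral_modulate_le hφ T
  -- real part of the archimedean term
  have hre_arch : (weilArchTerm (modulate k T)).re =
      (1 / (2 * π)) * (∫ τ : ℝ, ‖weilMellin φ (1 / 2 + ((τ - T : ℝ) : ℂ) * I)‖ ^ 2 *
        (Complex.digamma (1 / 4 + τ / 2 * I)).re) - (k 0).re * Real.log π := by
    rw [weilArchTerm, hk_def, weilArchIntegral_modulate_conv hφ T, modulate_zero, ← hk_def]
    have e1 : (1 / (2 * π) : ℂ) = ((1 / (2 * π) : ℝ) : ℂ) := by push_cast; ring
    rw [e1, Complex.sub_re, Complex.re_ofReal_mul, Complex.ofReal_re]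
    congr 1
    rw [Complex.mul_re, Complex.ofReal_re, Complex.ofReal_im, mul_zero, sub_zero]
  have hk0 : -((k 0).re * Real.log π) ≤ ‖k 0‖ * Real.log π := by
    have h1 : |(k 0).re| ≤ ‖k 0‖ := Complex.abs_re_le_norm _
    have h2 : 0 < Real.log π := Real.log_pos (by linarith [Real.pi_gt_three])
    nlinarith [neg_abs_le (k 0).re]
  have hW : (weilFunctional (modulate k T)).re =
      (weilPolarTerm (modulate k T)).re - (weilPrimeTerm (modulate k T)).re +
        (weilArchTerm (modulate k T)).re := by
    simp [weilFunctional]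
  rw [hW, hre_arch]
  have h1 : (weilPolarTerm (modulate k T)).re ≤ 2 * weilL1W (1 / 2) k :=
    (Complex.re_le_norm _).trans hpol
  have h2 : -(weilPrimeTerm (modulate k T)).re ≤ primeMajorant k := by
    have := Complex.abs_re_le_norm (weilPrimeTerm (modulate k T))
    linarith [neg_abs_le (weilPrimeTerm (modulate k T)).re]
  have hπ : 0 < 1 / (2 * π) := by positivity
  have h3 := mul_le_mul_of_nonneg_left harch hπ.le
  have e : 1 / (2 * π) * ((Real.log (3 + |T|) + 12) * sqMass φ + sqLogMass φ) =
      sqMass φ / (2 * π) * Real.log (3 + |T|) + (12 * sqMass φ + sqLogMass φ) / (2 * π) := by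
    field_simp
    ring
  rw [e] at h3
  linarith

/-! ### Local counting bound for every witness (uniform in the window) -/

/-- **Local counting law, upper half.** If `γ` realises `Trace A` (`A > 0`) then
`#{i : |γ_i − T| ≤ 1} ≤ C₁ log(3 + |T|) + C₂` for every real `T`; the constants depend only on
a bump of radius `min(A/2, 1)`, so they serve every larger window too (this is the uniform
estimate the route's `WindowCompactness` needs, and the upper half of the Weyl law
`N(T) = O(T log T)` for witnesses). -/
theorem ncard_near_le {A : ℝ} (hA : 0 < A) {ι : Type} {γ : ι → ℝ} (h : Trace A ι γ) :
    ∃ C₁ C₂ : ℝ, ∀ T : ℝ,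
      ({i : ι | |γ i - T| ≤ 1}.ncard : ℝ) ≤ C₁ * Real.log (3 + |T|) + C₂ := by
  -- a bump of radius `a = min (A/2) 1`
  set a : ℝ := min (A / 2) 1 with ha_def
  have ha : 0 < a := lt_min (by linarith) one_pos
  have haA : 2 * a ≤ A := by have := min_le_left (A / 2) 1; linarith
  have ha1 : a ≤ 1 := min_le_right _ _
  let b : ContDiffBump (0 : ℝ) := ⟨a / 2, a, by positivity, by linarith⟩
  set φ : ℝ → ℂ := fun t => ((b t : ℝ) : ℂ) with hφ_def
  have hφ : IsWeilTest φ :=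
    ⟨Complex.ofRealCLM.contDiff.comp b.contDiff, b.hasCompactSupport.comp_left Complex.ofReal_zero⟩
  have hφs : tsupport φ ⊆ Set.Icc (-a) a := by
    refine (tsupport_comp_subset Complex.ofReal_zero _).trans ?_
    rw [b.tsupport_eq, Real.closedBall_eq_Icc, zero_sub, zero_add]
  set c₀ : ℝ := Real.cos 1 * ∫ t, b t with hc₀
  have hcos : 0 < Real.cos 1 := Real.cos_pos_of_mem_Ioo ⟨by linarith [Real.pi_gt_three],
    by linarith [Real.pi_gt_three]⟩
  have hc₀pos : 0 < c₀ := mul_pos hcos b.integral_pos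
  -- the constants
  set k := weilConv φ (weilReflect φ) with hk_def
  set C₁ : ℝ := sqMass φ / (2 * π) with hC₁
  set C₂ : ℝ := 2 * weilL1W (1 / 2) k + primeMajorant k + (12 * sqMass φ + sqLogMass φ) / (2 * π) +
    ‖k 0‖ * Real.log π with hC₂
  refine ⟨C₁ / c₀ ^ 2, C₂ / c₀ ^ 2, fun T => ?_⟩
  have hS := hasSum_norm_sq_shift h hφ hφs haA T
  have hW := re_weilFunctional_modulate_le hφ T
  -- the near atoms form a finite set
  have hfin : {i : ι | |γ i - T| ≤ 1}.Finite := by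
    refine (Theorems.WindowTracePrime2.Negative.finite_abs_le_of_trace hA h (|T| + 1)).subset ?_
    intro i hi
    simp only [Set.mem_setOf_eq] at hi ⊢
    have := abs_add_le (γ i - T) T
    rw [sub_add_cancel] at this
    linarith
  -- each near atom contributes at least `c₀²`
  have hnear : ∀ i ∈ hfin.toFinset, c₀ ^ 2 ≤ ‖weilMellin φ (1 / 2 + ((γ i - T : ℝ) : ℂ) * I)‖ ^ 2 := by
    intro i hi
    rw [Set.Finite.mem_toFinset, Set.mem_setOf_eq] at hi
    have hγ : |γ i - T| * b.rOut ≤ 1 := by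
      calc |γ i - T| * b.rOut ≤ 1 * 1 := mul_le_mul hi ha1 b.rOut_pos.le zero_le_one
        _ = 1 := one_mul 1
    have hre := Theorems.WindowTracePrime2.Negative.re_weilMellin_bump_ge b hγ
    have hn : c₀ ≤ ‖weilMellin φ (1 / 2 + ((γ i - T : ℝ) : ℂ) * I)‖ :=
      hre.trans (Complex.re_le_norm _)
    nlinarith
  have hsum : ∑ i ∈ hfin.toFinset, ‖weilMellin φ (1 / 2 + ((γ i - T : ℝ) : ℂ) * I)‖ ^ 2 ≤
      (weilFunctional (modulate k T)).re :=
    sum_le_hasSum _ (fun i _ => by positivity) hS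
  have hcard : c₀ ^ 2 * (hfin.toFinset.card : ℝ) ≤
      ∑ i ∈ hfin.toFinset, ‖weilMellin φ (1 / 2 + ((γ i - T : ℝ) : ℂ) * I)‖ ^ 2 := by
    have := Finset.card_nsmul_le_sum hfin.toFinset _ (c₀ ^ 2) hnear
    rw [nsmul_eq_mul] at this
    linarith
  rw [Set.ncard_eq_toFinset_card _ hfin]
  have hc2 : 0 < c₀ ^ 2 := by positivity
  rw [div_mul_eq_mul_div, ← add_div, le_div_iff₀ hc2]
  calc (hfin.toFinset.card : ℝ) * c₀ ^ 2 = c₀ ^ 2 * hfin.toFinset.card := by ring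
    _ ≤ (weilFunctional (modulate k T)).re := hcard.trans hsum
    _ ≤ C₁ * Real.log (3 + |T|) + C₂ := by rw [hC₁, hC₂, hk_def]; exact hW

/-! ### Bounded local counts bound the shifted sums uniformly in `T` -/

/-- The summable profile `W_m = 1/(1+m²) + 1/(1+(m+1)²)` dominating `1/(1+u²)` on `[m, m+1)`. -/
theorem summable_profile :
    Summable fun m : ℤ => 1 / (1 + (m : ℝ) ^ 2) + 1 / (1 + ((m : ℝ) + 1) ^ 2) := by
  have hnat : Summable fun n : ℕ => 1 / (1 + (n : ℝ) ^ 2) := by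
    have h2 : Summable fun n : ℕ => 2 * (1 / ((n : ℝ) + 1) ^ 2) := by
      have := (summable_nat_add_iff 1).2 (Real.summable_one_div_nat_pow.2 one_lt_two)
      simpa using this.mul_left 2
    refine Summable.of_nonneg_of_le (fun n => by positivity) (fun n => ?_) h2
    rw [div_le_iff₀ (by positivity), show 2 * (1 / ((n : ℝ) + 1) ^ 2) * (1 + (n : ℝ) ^ 2) =
      2 * (1 + (n : ℝ) ^ 2) / ((n : ℝ) + 1) ^ 2 by ring, le_div_iff₀ (by positivity)]
    nlinarith [sq_nonneg ((n : ℝ) - 1), Nat.cast_nonneg (α := ℝ) n]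
  have hA : Summable fun m : ℤ => 1 / (1 + (m : ℝ) ^ 2) := by
    refine Summable.of_nat_of_neg_add_one (by simpa using hnat) ?_
    refine ((summable_nat_add_iff 1).2 hnat).congr fun n => ?_
    push_cast
    ring
  have hB : Summable fun m : ℤ => 1 / (1 + ((m : ℝ) + 1) ^ 2) := by
    have := (Equiv.addRight (1 : ℤ)).summable_iff.2 hA
    refine this.congr fun m => ?_
    simp
  exact hA.add hB

/-- The (nonnegative, `T`-independent) constant `Σ_m W_m`. -/
def profileSum : ℝ := ∑' m : ℤ, (1 / (1 + (m : ℝ) ^ 2) + 1 / (1 + ((m : ℝ) + 1) ^ 2))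

theorem profileSum_nonneg : 0 ≤ profileSum := tsum_nonneg fun _ => by positivity

theorem inv_one_add_sq_le_profile {u : ℝ} {m : ℤ} (hm : ⌊u⌋ = m) :
    1 / (1 + u ^ 2) ≤ 1 / (1 + (m : ℝ) ^ 2) + 1 / (1 + ((m : ℝ) + 1) ^ 2) := by
  have h1 : (m : ℝ) ≤ u := by rw [← hm]; exact Int.floor_le u
  have h2 : u < (m : ℝ) + 1 := by rw [← hm]; exact Int.lt_floor_add_one u
  rcases le_or_gt 0 (m : ℝ) with hm0 | hm0
  · have : 1 / (1 + u ^ 2) ≤ 1 / (1 + (m : ℝ) ^ 2) := by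
      apply one_div_le_one_div_of_le (by positivity)
      nlinarith
    linarith [show (0 : ℝ) ≤ 1 / (1 + ((m : ℝ) + 1) ^ 2) by positivity]
  · have : 1 / (1 + u ^ 2) ≤ 1 / (1 + ((m : ℝ) + 1) ^ 2) := by
      apply one_div_le_one_div_of_le (by positivity)
      have hm1 : (m : ℝ) + 1 ≤ 0 := by
        have : m ≤ -1 := by
          have : (m : ℝ) < 0 := hm0
          exact Int.le_sub_one_iff.2 (by exact_mod_cast this)
        have : (m : ℝ) ≤ -1 := by exact_mod_cast this
        linarith
      nlinarith
    linarith [show (0 : ℝ) ≤ 1 / (1 + (m : ℝ) ^ 2) by positivity]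

/-- **Regrouping under bounded local counts.** If every unit window `[S-1, S+1]` meets at most `M`
indices (a uniformly discrete family, a finite union of lattices, a Paley–Wiener zero set, …)
then every finite partial sum of `1/(1+(γ_i−T)²)` is `≤ M · profileSum`, uniformly in `T`. -/
theorem sum_inv_one_add_sq_le {ι : Type} (γ : ι → ℝ) {M : ℝ}
    (hfin : ∀ S : ℝ, {i : ι | |γ i - S| ≤ 1}.Finite)
    (hM : ∀ S : ℝ, ({i : ι | |γ i - S| ≤ 1}.ncard : ℝ) ≤ M) (T : ℝ) (s : Finset ι) :
    ∑ i ∈ s, 1 / (1 + (γ i - T) ^ 2) ≤ M * profileSum := by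
  classical
  have hM0 : 0 ≤ M := le_trans (by positivity) (hM 0)
  set g : ι → ℤ := fun i => ⌊γ i - T⌋ with hg
  set W : ℤ → ℝ := fun m => 1 / (1 + (m : ℝ) ^ 2) + 1 / (1 + ((m : ℝ) + 1) ^ 2) with hW
  -- regroup by the integer part of `γ_i - T`
  rw [← Finset.sum_fiberwise_of_maps_to (g := g) (t := s.image g) (fun i hi => Finset.mem_image_of_mem g hi)]
  -- each fibre: at most `M` terms, each `≤ W m`
  have hfib : ∀ m ∈ s.image g, ∑ i ∈ s with g i = m, 1 / (1 + (γ i - T) ^ 2) ≤ M * W m := by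
    intro m _
    have hcard : (((s.filter fun i => g i = m).card : ℕ) : ℝ) ≤ M := by
      have hsub : (↑(s.filter fun i => g i = m) : Set ι) ⊆ {i : ι | |γ i - (T + m + 1 / 2)| ≤ 1} := by
        intro i hi
        rw [Finset.coe_filter] at hi
        obtain ⟨_, him⟩ := hi
        have h1 : (m : ℝ) ≤ γ i - T := by rw [← him]; exact Int.floor_le _
        have h2 : γ i - T < (m : ℝ) + 1 := by rw [← him]; exact Int.lt_floor_add_one _
        simp only [Set.mem_setOf_eq]
        rw [abs_le]
        constructor <;> linarith
      have h := Set.ncard_le_ncard hsub (hfin _)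
      rw [Set.ncard_coe_finset] at h
      exact le_trans (by exact_mod_cast h) (hM _)
    have hterm : ∀ i ∈ s.filter (fun i => g i = m), 1 / (1 + (γ i - T) ^ 2) ≤ W m := by
      intro i hi
      exact inv_one_add_sq_le_profile (Finset.mem_filter.1 hi).2
    calc ∑ i ∈ s with g i = m, 1 / (1 + (γ i - T) ^ 2)
        ≤ ∑ i ∈ s with g i = m, W m := Finset.sum_le_sum hterm
      _ = ((s.filter fun i => g i = m).card : ℝ) * W m := by rw [Finset.sum_const, nsmul_eq_mul]
      _ ≤ M * W m := mul_le_mul_of_nonneg_right hcard (by positivity)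
  calc ∑ m ∈ s.image g, ∑ i ∈ s with g i = m, 1 / (1 + (γ i - T) ^ 2)
      ≤ ∑ m ∈ s.image g, M * W m := Finset.sum_le_sum hfib
    _ = M * ∑ m ∈ s.image g, W m := by rw [Finset.mul_sum]
    _ ≤ M * profileSum := by
        refine mul_le_mul_of_nonneg_left ?_ hM0
        exact (summable_profile.sum_le_tsum (s.image g) fun m _ => by positivity)

/-- `|φ̂(1/2+iu)|² ≤ D²/(1+u²)` with `D = weilDecayW 0 φ`. -/
theorem norm_sq_weilMellin_le {φ : ℝ → ℂ} (hφ : IsWeilTest φ) (u : ℝ) :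
    ‖weilMellin φ (1 / 2 + (u : ℂ) * I)‖ ^ 2 ≤ weilDecayW 0 φ ^ 2 * (1 / (1 + u ^ 2)) := by
  have h := norm_weilMellin_vertical_le hφ (1 / 2) u
  rw [show |(1 / 2 : ℝ) - 1 / 2| = 0 by norm_num] at h
  have e : (((1 / 2 : ℝ) : ℂ) + u * I) = 1 / 2 + (u : ℂ) * I := by push_cast; ring
  rw [e] at h
  have hD : 0 ≤ weilDecayW 0 φ := weilDecayW_nonneg 0 φ
  have h0 : 0 ≤ ‖weilMellin φ (1 / 2 + (u : ℂ) * I)‖ := norm_nonneg _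
  have hinv : (1 + u ^ 2)⁻¹ ≤ 1 := inv_le_one_of_one_le₀ (by nlinarith)
  have hinv0 : 0 ≤ (1 + u ^ 2)⁻¹ := by positivity
  calc ‖weilMellin φ (1 / 2 + (u : ℂ) * I)‖ ^ 2 ≤ (weilDecayW 0 φ * (1 + u ^ 2)⁻¹) ^ 2 :=
        pow_le_pow_left₀ h0 h 2
    _ = weilDecayW 0 φ ^ 2 * (1 + u ^ 2)⁻¹ * (1 + u ^ 2)⁻¹ := by ring
    _ ≤ weilDecayW 0 φ ^ 2 * (1 + u ^ 2)⁻¹ * 1 := by gcongr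
    _ = weilDecayW 0 φ ^ 2 * (1 / (1 + u ^ 2)) := by ring

/-- **Under bounded local counts `Re W(k_T)` is bounded uniformly in `T`.** -/
theorem re_weilFunctional_modulate_le_of_ncard_le {A : ℝ} {ι : Type} {γ : ι → ℝ} (h : Trace A ι γ)
    {φ : ℝ → ℂ} (hφ : IsWeilTest φ) {a : ℝ} (hφs : tsupport φ ⊆ Set.Icc (-a) a) (h2a : 2 * a ≤ A)
    {M : ℝ} (hfin : ∀ S : ℝ, {i : ι | |γ i - S| ≤ 1}.Finite)
    (hM : ∀ S : ℝ, ({i : ι | |γ i - S| ≤ 1}.ncard : ℝ) ≤ M) (T : ℝ) :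
    (weilFunctional (modulate (weilConv φ (weilReflect φ)) T)).re ≤
      weilDecayW 0 φ ^ 2 * (M * profileSum) := by
  have hS := hasSum_norm_sq_shift h hφ hφs h2a T
  refine hasSum_le_of_sum_le hS fun s => ?_
  calc ∑ i ∈ s, ‖weilMellin φ (1 / 2 + ((γ i - T : ℝ) : ℂ) * I)‖ ^ 2
      ≤ ∑ i ∈ s, weilDecayW 0 φ ^ 2 * (1 / (1 + (γ i - T) ^ 2)) :=
        Finset.sum_le_sum fun i _ => norm_sq_weilMellin_le hφ (γ i - T)
    _ = weilDecayW 0 φ ^ 2 * ∑ i ∈ s, 1 / (1 + (γ i - T) ^ 2) := by rw [Finset.mul_sum]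
    _ ≤ weilDecayW 0 φ ^ 2 * (M * profileSum) :=
        mul_le_mul_of_nonneg_left (sum_inv_one_add_sq_le γ hfin hM T s) (sq_nonneg _)

/-! ### Lower bound: `Re W(k_T) → +∞` for every fixed test -/

theorem integrable_norm_sq_weilMellin {φ : ℝ → ℂ} (hφ : IsWeilTest φ) :
    Integrable fun u : ℝ => ‖weilMellin φ (1 / 2 + (u : ℂ) * I)‖ ^ 2 := by
  have h := integrable_norm_sq_weilMellin_mul hφ (L := fun _ => (1 : ℝ)) continuous_const (C := 1)
    fun u => by rw [abs_one]; linarith [abs_nonneg u]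
  simpa using h

/-- The shifted integrand `|φ̂(τ−T)|² Re ψ(1/4+iτ/2)` is integrable. -/
theorem integrable_shift_mul_re_digamma {φ : ℝ → ℂ} (hφ : IsWeilTest φ) (T : ℝ) :
    Integrable fun τ : ℝ => ‖weilMellin φ (1 / 2 + ((τ - T : ℝ) : ℂ) * I)‖ ^ 2 *
      (Complex.digamma (1 / 4 + τ / 2 * I)).re := by
  have hmod : ∀ τ : ℝ, ‖weilMellin φ (1 / 2 + ((τ - T : ℝ) : ℂ) * I)‖ ^ 2 =
      ‖weilMellin (modulate φ T) (1 / 2 + (τ : ℂ) * I)‖ ^ 2 := fun τ => by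
    rw [weilMellin_modulate]
    congr 3
    push_cast
    ring
  have h := integrable_norm_sq_weilMellin_mul (isWeilTest_modulate hφ T)
    continuous_re_digamma_quarter (C := 14) fun τ => by
      have h1 := abs_re_digamma_quarter_le τ
      have h2 : Real.log (3 + |τ|) ≤ 2 + |τ| := by
        have := Real.log_le_sub_one_of_pos (by positivity : (0 : ℝ) < 3 + |τ|)
        linarith
      nlinarith [abs_nonneg τ, abs_nonneg ((Complex.digamma (1 / 4 + τ / 2 * I)).re)]
  exact h.congr (Eventually.of_forall fun τ => by simp only [hmod])

/-- Lower Stirling bound on the near window: for `τ − T ∈ (−R, R]`, `T ≥ 2R + 4`,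
`Re ψ(1/4 + iτ/2) ≥ log(T/4) − K₀`, `K₀ = stirlingVertRate (1/4)`. -/
theorem re_digamma_quarter_ge_near {R T τ : ℝ} (hT : 2 * R + 4 ≤ T)
    (hτ : τ - T ∈ Set.Ioc (-R) R) :
    Real.log (T / 4) - stirlingVertRate (1 / 4) ≤ (Complex.digamma (1 / 4 + τ / 2 * I)).re := by
  have hτ1 : T - R < τ := by have := hτ.1; linarith
  have hR : 0 ≤ R := by have := hτ.1; have := hτ.2; linarith
  have hτ2 : 2 ≤ τ := by linarith
  have h := abs_re_digamma_vertical_sub_log_le (σ := 1 / 4) (u := τ / 2) (by norm_num) (by linarith)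
  have e : ((1 / 4 : ℝ) : ℂ) + ((τ / 2 : ℝ) : ℂ) * I = 1 / 4 + τ / 2 * I := by push_cast; ring
  rw [e] at h
  have h1 := (abs_le.1 h).1
  have hK : 0 ≤ stirlingVertRate (1 / 4) := by unfold stirlingVertRate; positivity
  have h2 : stirlingVertRate (1 / 4) / (τ / 2) ^ 2 ≤ stirlingVertRate (1 / 4) :=
    div_le_self hK (by nlinarith)
  have h3 : Real.log (T / 4) ≤ Real.log (τ / 2) := Real.log_le_log (by linarith) (by linarith)
  linarith

/-- **Lower bound for the archimedean integral of `k_T`** in terms of the mass of `|φ̂|²` on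
`(−R, R]`: `∫ |φ̂(τ−T)|² Re ψ ≥ (log(T/4) − K₀) m_R − (log(3+|T|)+12)(M₀ − m_R) − M₁`. -/
theorem archIntegral_modulate_ge {φ : ℝ → ℂ} (hφ : IsWeilTest φ) {R T : ℝ} (hT : 2 * R + 4 ≤ T) :
    (Real.log (T / 4) - stirlingVertRate (1 / 4)) *
        (∫ u in Set.Ioc (-R) R, ‖weilMellin φ (1 / 2 + (u : ℂ) * I)‖ ^ 2) -
      (Real.log (3 + |T|) + 12) *
        (sqMass φ - ∫ u in Set.Ioc (-R) R, ‖weilMellin φ (1 / 2 + (u : ℂ) * I)‖ ^ 2) -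
      sqLogMass φ ≤
    ∫ τ : ℝ, ‖weilMellin φ (1 / 2 + ((τ - T : ℝ) : ℂ) * I)‖ ^ 2 *
        (Complex.digamma (1 / 4 + τ / 2 * I)).re := by
  have hI1 := integrable_shift_mul_re_digamma hφ T
  set F : ℝ → ℝ := fun u => ‖weilMellin φ (1 / 2 + (u : ℂ) * I)‖ ^ 2 with hF
  have hFnn : ∀ u, 0 ≤ F u := fun u => by positivity
  set c₁ : ℝ := Real.log (T / 4) - stirlingVertRate (1 / 4) with hc₁
  set c₂ : ℝ := Real.log (3 + |T|) + 12 with hc₂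
  set S : Set ℝ := Set.Ioc (-R) R with hSdef
  have hSm : MeasurableSet S := measurableSet_Ioc
  have hFi : Integrable F := integrable_norm_sq_weilMellin hφ
  have hFL : Integrable fun u : ℝ => F u * Real.log (1 + |u|) :=
    integrable_norm_sq_weilMellin_mul hφ continuous_log_one_add_abs log_one_add_abs_le
  have hF2 : Integrable fun u : ℝ => F u * (c₂ + Real.log (1 + |u|)) := by
    have : (fun u : ℝ => F u * (c₂ + Real.log (1 + |u|))) =
        fun u => F u * c₂ + F u * Real.log (1 + |u|) := by funext u; ring
    rw [this]
    exact (hFi.mul_const c₂).add hFL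
  -- the minorant
  set G : ℝ → ℝ := fun u => S.indicator (fun u => F u * c₁) u -
    Sᶜ.indicator (fun u => F u * (c₂ + Real.log (1 + |u|))) u with hG
  have hGi : Integrable G := ((hFi.mul_const c₁).indicator hSm).sub (hF2.indicator hSm.compl)
  have hle : ∀ τ : ℝ, G (τ - T) ≤ ‖weilMellin φ (1 / 2 + ((τ - T : ℝ) : ℂ) * I)‖ ^ 2 *
      (Complex.digamma (1 / 4 + τ / 2 * I)).re := by
    intro τ
    have hFeq : ‖weilMellin φ (1 / 2 + ((τ - T : ℝ) : ℂ) * I)‖ ^ 2 = F (τ - T) := by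
      simp only [hF]
    rw [hFeq]
    by_cases hmem : τ - T ∈ S
    · have hnot : τ - T ∉ Sᶜ := fun h' => h' hmem
      simp only [hG, Set.indicator_of_mem hmem, Set.indicator_of_notMem hnot, sub_zero]
      exact mul_le_mul_of_nonneg_left (re_digamma_quarter_ge_near hT hmem) (hFnn _)
    · have hmem' : τ - T ∈ Sᶜ := hmem
      simp only [hG, Set.indicator_of_notMem hmem, Set.indicator_of_mem hmem', zero_sub]
      have hb : |(Complex.digamma (1 / 4 + τ / 2 * I)).re| ≤ c₂ + Real.log (1 + |τ - T|) := by
        have := abs_re_digamma_quarter_le τ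
        have := log_three_add_abs_le T τ
        linarith
      have hψ : -(c₂ + Real.log (1 + |τ - T|)) ≤ (Complex.digamma (1 / 4 + τ / 2 * I)).re := by
        linarith [neg_abs_le (Complex.digamma (1 / 4 + τ / 2 * I)).re]
      have := mul_le_mul_of_nonneg_left hψ (hFnn (τ - T))
      linarith
  have hmono : ∫ τ, G (τ - T) ≤ ∫ τ : ℝ, ‖weilMellin φ (1 / 2 + ((τ - T : ℝ) : ℂ) * I)‖ ^ 2 *
      (Complex.digamma (1 / 4 + τ / 2 * I)).re := integral_mono (hGi.comp_sub_right T) hI1 hle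
  have hshift : ∫ τ, G (τ - T) = ∫ u, G u := integral_sub_right_eq_self (fun u => G u) T
  have hGint : ∫ u, G u = c₁ * (∫ u in S, F u) - ∫ u in Sᶜ, F u * (c₂ + Real.log (1 + |u|)) := by
    simp only [hG]
    rw [integral_sub ((hFi.mul_const c₁).indicator hSm) (hF2.indicator hSm.compl),
      integral_indicator hSm, integral_indicator hSm.compl, integral_mul_const]
    ring
  have hcompl : ∫ u in Sᶜ, F u * (c₂ + Real.log (1 + |u|)) ≤
      c₂ * (sqMass φ - ∫ u in S, F u) + sqLogMass φ := by
    have e1 : ∫ u in Sᶜ, F u * (c₂ + Real.log (1 + |u|)) =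
        c₂ * (∫ u in Sᶜ, F u) + ∫ u in Sᶜ, F u * Real.log (1 + |u|) := by
      have : (fun u : ℝ => F u * (c₂ + Real.log (1 + |u|))) =
          fun u => c₂ * F u + F u * Real.log (1 + |u|) := by funext u; ring
      rw [this, integral_add (hFi.const_mul c₂).integrableOn hFL.integrableOn, integral_const_mul]
    have e2 : ∫ u in Sᶜ, F u = sqMass φ - ∫ u in S, F u := by
      have := integral_add_compl hSm hFi
      rw [sqMass]
      linarith
    have e3 : ∫ u in Sᶜ, F u * Real.log (1 + |u|) ≤ sqLogMass φ := by
      rw [sqLogMass]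
      exact setIntegral_le_integral hFL (Eventually.of_forall fun u =>
        mul_nonneg (hFnn u) (Real.log_nonneg (by linarith [abs_nonneg u])))
    rw [e1, e2]
    linarith
  calc c₁ * (∫ u in S, F u) - c₂ * (sqMass φ - ∫ u in S, F u) - sqLogMass φ
      ≤ c₁ * (∫ u in S, F u) - ∫ u in Sᶜ, F u * (c₂ + Real.log (1 + |u|)) := by linarith
    _ = ∫ u, G u := hGint.symm
    _ = ∫ τ, G (τ - T) := hshift.symm
    _ ≤ _ := hmono

/-- **Lower bound for `Re W(k_T)`**, `k = φ ⋆ φ̃`, in terms of the mass `m_R` of `|φ̂|²` on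
`(−R, R]`. -/
theorem re_weilFunctional_modulate_ge {φ : ℝ → ℂ} (hφ : IsWeilTest φ) {R T : ℝ}
    (hT : 2 * R + 4 ≤ T) :
    1 / (2 * π) * ((Real.log (T / 4) - stirlingVertRate (1 / 4)) *
          (∫ u in Set.Ioc (-R) R, ‖weilMellin φ (1 / 2 + (u : ℂ) * I)‖ ^ 2) -
        (Real.log (3 + |T|) + 12) *
          (sqMass φ - ∫ u in Set.Ioc (-R) R, ‖weilMellin φ (1 / 2 + (u : ℂ) * I)‖ ^ 2) -
        sqLogMass φ) -
      (2 * weilL1W (1 / 2) (weilConv φ (weilReflect φ)) +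
        primeMajorant (weilConv φ (weilReflect φ)) +
        ‖weilConv φ (weilReflect φ) 0‖ * Real.log π) ≤
    (weilFunctional (modulate (weilConv φ (weilReflect φ)) T)).re := by
  set k := weilConv φ (weilReflect φ) with hk_def
  have hk : IsWeilTest k := hφ.weilConv hφ.weilReflect
  have hpol := norm_weilPolarTerm_modulate_le hk T
  have hpri := norm_weilPrimeTerm_modulate_le hk.2 T
  have harch := archIntegral_modulate_ge hφ hT
  have hre_arch : (weilArchTerm (modulate k T)).re =
      (1 / (2 * π)) * (∫ τ : ℝ, ‖weilMellin φ (1 / 2 + ((τ - T : ℝ) : ℂ) * I)‖ ^ 2 *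
        (Complex.digamma (1 / 4 + τ / 2 * I)).re) - (k 0).re * Real.log π := by
    rw [weilArchTerm, hk_def, weilArchIntegral_modulate_conv hφ T, modulate_zero, ← hk_def]
    have e1 : (1 / (2 * π) : ℂ) = ((1 / (2 * π) : ℝ) : ℂ) := by push_cast; ring
    rw [e1, Complex.sub_re, Complex.re_ofReal_mul, Complex.ofReal_re]
    congr 1
    rw [Complex.mul_re, Complex.ofReal_re, Complex.ofReal_im, mul_zero, sub_zero]
  have hk0 : (k 0).re * Real.log π ≤ ‖k 0‖ * Real.log π := by
    have h1 : (k 0).re ≤ ‖k 0‖ := Complex.re_le_norm _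
    have h2 : 0 < Real.log π := Real.log_pos (by linarith [Real.pi_gt_three])
    nlinarith
  have hW : (weilFunctional (modulate k T)).re =
      (weilPolarTerm (modulate k T)).re - (weilPrimeTerm (modulate k T)).re +
        (weilArchTerm (modulate k T)).re := by
    simp [weilFunctional]
  rw [hW, hre_arch]
  have h1 : -(2 * weilL1W (1 / 2) k) ≤ (weilPolarTerm (modulate k T)).re := by
    have := Complex.abs_re_le_norm (weilPolarTerm (modulate k T))
    linarith [neg_abs_le (weilPolarTerm (modulate k T)).re]
  have h2 : (weilPrimeTerm (modulate k T)).re ≤ primeMajorant k :=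
    (Complex.re_le_norm _).trans hpri
  have hπ : 0 < 1 / (2 * π) := by positivity
  have h3 := mul_le_mul_of_nonneg_left harch hπ.le
  linarith

/-- The mass of `|φ̂|²` near the origin is positive for a non-negative bump of radius `≤ 1`:
`sqMass ≥ 2 (cos 1 · ∫ b)²`. -/
theorem sqMass_bump_pos (b : ContDiffBump (0 : ℝ)) (hb : b.rOut ≤ 1) :
    2 * (Real.cos 1 * ∫ t, b t) ^ 2 ≤ sqMass (fun t => ((b t : ℝ) : ℂ)) := by
  set φ : ℝ → ℂ := fun t => ((b t : ℝ) : ℂ) with hφ_def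
  have hφ : IsWeilTest φ :=
    ⟨Complex.ofRealCLM.contDiff.comp b.contDiff, b.hasCompactSupport.comp_left Complex.ofReal_zero⟩
  set c₀ : ℝ := Real.cos 1 * ∫ t, b t with hc₀
  have hcos : 0 < Real.cos 1 := Real.cos_pos_of_mem_Ioo ⟨by linarith [Real.pi_gt_three],
    by linarith [Real.pi_gt_three]⟩
  have hc₀pos : 0 < c₀ := mul_pos hcos b.integral_pos
  have hFi : Integrable fun u : ℝ => ‖weilMellin φ (1 / 2 + (u : ℂ) * I)‖ ^ 2 :=
    integrable_norm_sq_weilMellin hφ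
  have hlow : ∀ u ∈ Set.Icc (-1 : ℝ) 1, c₀ ^ 2 ≤ ‖weilMellin φ (1 / 2 + (u : ℂ) * I)‖ ^ 2 := by
    intro u hu
    have hγ : |u| * b.rOut ≤ 1 := by
      have : |u| ≤ 1 := abs_le.2 ⟨hu.1, hu.2⟩
      calc |u| * b.rOut ≤ 1 * 1 := mul_le_mul this hb b.rOut_pos.le zero_le_one
        _ = 1 := one_mul 1
    have hre := Theorems.WindowTracePrime2.Negative.re_weilMellin_bump_ge b hγ
    have hn : c₀ ≤ ‖weilMellin φ (1 / 2 + (u : ℂ) * I)‖ := hre.trans (Complex.re_le_norm _)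
    nlinarith
  have h1 := setIntegral_ge_of_const_le (μ := volume) measurableSet_Icc
    (by rw [Real.volume_Icc]; exact ENNReal.ofReal_ne_top) hlow hFi.integrableOn
  rw [Real.volume_real_Icc_of_le (by norm_num), smul_eq_mul] at h1
  have h2 := setIntegral_le_integral (s := Set.Icc (-1 : ℝ) 1) hFi
    (Eventually.of_forall fun u => by positivity)
  rw [sqMass]
  linarith

/-- **No witness has bounded local counts.** If `sup_S #{i : |γ_i − S| ≤ 1} ≤ M < ∞` then `γ`
realises no window `A > 0`. This kills every UNIFORMLY DISCRETE family (in particular every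
finite union of lattices or of separated sequences, every zero set of a sine-type /
Paley–Wiener function), and any family with linear counting `N(T) = O(T)`: witnesses must
cluster logarithmically, `#{i : |γ_i − T| ≤ R} → ∞` (the lower half of the Weyl law). -/
theorem not_trace_of_ncard_le {A : ℝ} (hA : 0 < A) {ι : Type} {γ : ι → ℝ} {M : ℝ}
    (hM : ∀ S : ℝ, ({i : ι | |γ i - S| ≤ 1}.ncard : ℝ) ≤ M) : ¬ Trace A ι γ := by
  intro h
  have hfin : ∀ S : ℝ, {i : ι | |γ i - S| ≤ 1}.Finite := fun S => by
    refine (Theorems.WindowTracePrime2.Negative.finite_abs_le_of_trace hA h (|S| + 1)).subset ?_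
    intro i hi
    simp only [Set.mem_setOf_eq] at hi ⊢
    have := abs_add_le (γ i - S) S
    rw [sub_add_cancel] at this
    linarith
  -- the bump of radius `a = min (A/2) 1`
  set a : ℝ := min (A / 2) 1 with ha_def
  have ha : 0 < a := lt_min (by linarith) one_pos
  have haA : 2 * a ≤ A := by have := min_le_left (A / 2) 1; linarith
  have ha1 : a ≤ 1 := min_le_right _ _
  let b : ContDiffBump (0 : ℝ) := ⟨a / 2, a, by positivity, by linarith⟩
  set φ : ℝ → ℂ := fun t => ((b t : ℝ) : ℂ) with hφ_def
  have hφ : IsWeilTest φ :=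
    ⟨Complex.ofRealCLM.contDiff.comp b.contDiff, b.hasCompactSupport.comp_left Complex.ofReal_zero⟩
  have hφs : tsupport φ ⊆ Set.Icc (-a) a := by
    refine (tsupport_comp_subset Complex.ofReal_zero _).trans ?_
    rw [b.tsupport_eq, Real.closedBall_eq_Icc, zero_sub, zero_add]
  set k := weilConv φ (weilReflect φ) with hk_def
  -- uniform upper bound from the bounded local counts
  set U : ℝ := weilDecayW 0 φ ^ 2 * (M * profileSum) with hU
  have hup : ∀ T, (weilFunctional (modulate k T)).re ≤ U := fun T =>
    re_weilFunctional_modulate_le_of_ncard_le h hφ hφs haA hfin hM T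
  -- positive mass and the choice of `R`
  have hFi : Integrable fun u : ℝ => ‖weilMellin φ (1 / 2 + (u : ℂ) * I)‖ ^ 2 :=
    integrable_norm_sq_weilMellin hφ
  have hM₀ : 0 < sqMass φ := by
    have h1 := sqMass_bump_pos b ha1
    have hcos : 0 < Real.cos 1 := Real.cos_pos_of_mem_Ioo ⟨by linarith [Real.pi_gt_three],
      by linarith [Real.pi_gt_three]⟩
    have h0 : 0 < Real.cos 1 * ∫ t, b t := mul_pos hcos (b.integral_pos (μ := volume))
    have : 0 < (Real.cos 1 * ∫ t, b t) ^ 2 := by positivity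
    linarith
  have hlim : Tendsto (fun R : ℝ => ∫ u in -R..R, ‖weilMellin φ (1 / 2 + (u : ℂ) * I)‖ ^ 2) atTop
      (𝓝 (sqMass φ)) :=
    intervalIntegral_tendsto_integral hFi tendsto_neg_atTop_atBot tendsto_id
  have hev : ∀ᶠ R : ℝ in atTop, 3 / 4 * sqMass φ < ∫ u in -R..R, ‖weilMellin φ (1 / 2 + (u : ℂ) * I)‖ ^ 2 :=
    hlim.eventually (Ioi_mem_nhds (by linarith))
  obtain ⟨R, hR0, hR⟩ := ((eventually_ge_atTop (0 : ℝ)).and hev).exists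
  rw [intervalIntegral.integral_of_le (by linarith : -R ≤ R)] at hR
  -- a large height `T`
  have hlow_all := fun (T : ℝ) (hT1 : 2 * R + 4 ≤ T) => re_weilFunctional_modulate_ge hφ hT1
  set mR : ℝ := ∫ u in Set.Ioc (-R) R, ‖weilMellin φ (1 / 2 + (u : ℂ) * I)‖ ^ 2 with hmR
  set K₀ : ℝ := stirlingVertRate (1 / 4) with hK₀
  set C₃ : ℝ := 2 * weilL1W (1 / 2) (weilConv φ (weilReflect φ)) +
    primeMajorant (weilConv φ (weilReflect φ)) + ‖weilConv φ (weilReflect φ) 0‖ * Real.log π with hC₃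
  set M₁ : ℝ := sqLogMass φ with hM₁
  set M₀ : ℝ := sqMass φ with hM₀def
  have hmM : mR ≤ M₀ := by
    rw [hmR, hM₀def, sqMass]
    exact setIntegral_le_integral hFi (Eventually.of_forall fun u => by positivity)
  have hm0 : 0 < mR := by linarith
  set α : ℝ := mR / (3 * π) with hα
  have hαpos : 0 < α := by positivity
  set B : ℝ := (U + C₃ + (M₁ + (Real.log 4 + K₀ + 8) * mR) / (2 * π) + 1) / α with hB
  set T : ℝ := max (2 * R + 4) (Real.exp |B|) with hTdef
  have hT1 : 2 * R + 4 ≤ T := le_max_left _ _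
  have hT4 : 4 ≤ T := by linarith
  have hTpos : 0 < T := by linarith
  have hlogT : |B| ≤ Real.log T := by
    rw [← Real.log_exp |B|]
    exact Real.log_le_log (Real.exp_pos _) (le_max_right _ _)
  have hlogT' : B ≤ Real.log T := (le_abs_self B).trans hlogT
  have hlog0 : 0 ≤ Real.log T := Real.log_nonneg (by linarith)
  have hlow := hlow_all T hT1
  have hupT := hup T
  -- compare: the lower bound exceeds `U`
  have hc₁ : Real.log (T / 4) = Real.log T - Real.log 4 := Real.log_div (by linarith) (by norm_num)
  have hc₂ : Real.log (3 + |T|) ≤ Real.log T + Real.log 4 := by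
    rw [abs_of_pos hTpos, ← Real.log_mul (by linarith) (by norm_num)]
    exact Real.log_le_log (by linarith) (by linarith)
  have hgap : M₀ - mR ≤ mR / 3 := by linarith
  have hgap0 : 0 ≤ M₀ - mR := by linarith
  have hlog4 : 0 ≤ Real.log 4 := Real.log_nonneg (by norm_num)
  have hlog4le : Real.log 4 ≤ 3 := by
    have := Real.log_le_sub_one_of_pos (by norm_num : (0 : ℝ) < 4)
    linarith
  have t1 : (Real.log (3 + |T|) + 12) * (M₀ - mR) ≤ (Real.log T + Real.log 4 + 12) * (mR / 3) := by
    calc (Real.log (3 + |T|) + 12) * (M₀ - mR)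
        ≤ (Real.log T + Real.log 4 + 12) * (M₀ - mR) :=
          mul_le_mul_of_nonneg_right (by linarith) hgap0
      _ ≤ (Real.log T + Real.log 4 + 12) * (mR / 3) :=
          mul_le_mul_of_nonneg_left hgap (by linarith)
  have t3 : Real.log 4 * mR ≤ 3 * mR := mul_le_mul_of_nonneg_right hlog4le hm0.le
  have key : α * Real.log T * (2 * π) - (M₁ + (Real.log 4 + K₀ + 8) * mR) ≤
      (Real.log (T / 4) - K₀) * mR - (Real.log (3 + |T|) + 12) * (M₀ - mR) - M₁ := by
    rw [hc₁, hα]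
    have e : mR / (3 * π) * Real.log T * (2 * π) = 2 / 3 * (Real.log T * mR) := by
      field_simp
    rw [e]
    nlinarith [t1, t3, hlog0, hm0.le, hlog4]
  have hπ : 0 < 2 * π := by positivity
  have key2 : α * Real.log T - (M₁ + (Real.log 4 + K₀ + 8) * mR) / (2 * π) - C₃ ≤
      (weilFunctional (modulate (weilConv φ (weilReflect φ)) T)).re := by
    have h5 : 1 / (2 * π) * (α * Real.log T * (2 * π) - (M₁ + (Real.log 4 + K₀ + 8) * mR)) =
        α * Real.log T - (M₁ + (Real.log 4 + K₀ + 8) * mR) / (2 * π) := by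
      field_simp
    have h6 := mul_le_mul_of_nonneg_left key (by positivity : (0 : ℝ) ≤ 1 / (2 * π))
    rw [h5] at h6
    linarith
  have hαB : α * B ≤ α * Real.log T := mul_le_mul_of_nonneg_left hlogT' hαpos.le
  have hαB' : α * B = U + C₃ + (M₁ + (Real.log 4 + K₀ + 8) * mR) / (2 * π) + 1 := by
    rw [hB]
    field_simp
  have hupT' : (weilFunctional (modulate (weilConv φ (weilReflect φ)) T)).re ≤ U := by
    rw [← hk_def]; exact hupT
  linarith

end Summit.RiemannHypothesis.RiemannHypothesis.Cruxes.WindowTracePrime2.Disproof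

end
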